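import Literature.NumberTheory.EllipticCurves.HeckeOperators
import Literature.NumberTheory.EllipticCurves.HeckeOperatorsProofs

/-!
# Hecke operators on `S_k(Γ₁(N))`: `T_p` via explicit coset representatives and commutativity of
the Hecke algebra (proofs)

Sibling proofs file of `Literature.NumberTheory.EllipticCurves.HeckeOperators`. It builds on
`HeckeOperatorsProofs.lean` (which discharges the double coset formula
`heckeCorrespondence_apply_eq_sum_slash_holds` / `heckeOperator_apply_eq_sum_slash_holds`,
Diamond–Shurman Lemma 5.1.2 and (5.1), and treats `T_p` on `S_k(Γ₀(N))`) and discharges,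
sorry-free, the named fact

* `heckeAlgebra_commutative_holds`: the Hecke algebra `ℂ[T_p : p prime] ⊆ End S_k(Γ₁(N))` is
  commutative (Diamond–Shurman, *A first course in modular forms*, Prop. 5.2.4(c) — PDF
  pp. 193–194 of the held copy — and §5.3).

On the way (all stated for Mathlib's slash action `f ∣[k] g`, i.e. Diamond–Shurman's `f[g]_k`):

* the explicit coset decomposition `Γ₁(N) diag(1,p) Γ₁(N) = ⊔_{0 ≤ j < p} Γ₁(N) (1 j; 0 p) ⊔
  [p ∤ N] Γ₁(N) (m n; N p) diag(p, 1)` (Diamond–Shurman (5.2) and the proof of Prop. 5.2.1 via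
  (5.3)), as `beta_reps_of_dvd` / `beta_reps_of_not_dvd`, and the resulting formula for
  `heckeT (Gamma1 N) k p` (`heckeT_gamma1_apply`). The tree already has Prop. 5.2.1 at level
  `Γ₁(N)` as `coe_heckeT_gamma1_eq_sum_of_dvd` / `coe_heckeT_gamma1_eq_sum_of_not_dvd`
  (`HeckeOperatorsGamma1QExpansionProofs.lean`), with the *fixed* representative
  `β_∞ = (m n; N p) diag(p, 1)` of (5.2); the form proved here is parametrised by an *arbitrary*
  `σ ∈ Γ₀(N)` with lower-right entry `≡ p (mod N)` (`β_∞ = σ diag(p, 1)`) and comes with the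
  `Γ₀(N)`-conjugated systems of representatives (`reps_conj`, `exists_reps`), which is exactly what
  the commutativity computation `heckeT_comm_of_prime` needs (it uses `σ_p σ_q` and `σ_q σ_p` as
  the `σ` for `T_{pq}`-type terms); this is why it is not derived from that pair;
* `T_p (f ∣ τ) = (T_p f) ∣ τ` for `τ ∈ Γ₀(N)` (`heckeT_slash_gamma0`; the content of
  Diamond–Shurman Prop. 5.2.4(a), `⟨d⟩ T_p = T_p ⟨d⟩`);
* `heckeT_comm_of_prime`: `T_p T_q = T_q T_p` on `S_k(Γ₁(N))` for primes `p, q`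
  (Diamond–Shurman Prop. 5.2.4(c)). Diamond–Shurman prove (c) from the `q`-expansion formula (5.4)
  on each eigenspace `M_k(N, χ)`; we follow instead the direct double-coset computation
  (matrix algebra with the representatives (5.2), cf. Shimura 1971, §3.3–3.4): both `T_p T_q f` and
  `T_q T_p f` equal
  `∑_{t < pq} f ∣ (1 t; 0 pq) + ∑ᵢ f ∣ β^{(p)}_i σ_q diag(q,1) + ∑ⱼ f ∣ β^{(q)}_j σ_p diag(p,1)
  + f ∣ σ_p σ_q diag(pq, 1)` modulo `Γ₁(N)`-invariance of `f`.

## References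

* F. Diamond, J. Shurman, *A first course in modular forms*, GTM 228, Springer 2005, §5.1
  (Lemma 5.1.2, Def. 5.1.3, (5.1)), §5.2 ((5.2), (5.3), Prop. 5.2.1, Prop. 5.2.4), §5.3.
  doi:10.1007/978-0-387-27226-9
* G. Shimura, *Introduction to the arithmetic theory of automorphic functions*, 1971, §3.3–3.4.
-/

noncomputable section

open scoped MatrixGroups ModularForm
open ConjAct Pointwise UpperHalfPlane CongruenceSubgroup

namespace Literature.NumberTheory.EllipticCurves.ModularForms

/-! ### Integer matrices: the double coset `Γ₁(N) diag(1,p) Γ₁(N)` (Diamond–Shurman (5.2), §5.2) -/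

section IntMatrices

variable {N : ℕ} {p : ℕ}

/-- A matrix in `SL(2, ℤ)` whose first column is `≡ (1, 0) (mod N)` lies in `Γ₁(N)`. [folklore] -/
theorem mem_Gamma1_of_col {γ : SL(2, ℤ)} (h00 : ((γ 0 0 : ℤ) : ZMod N) = 1)
    (h10 : ((γ 1 0 : ℤ) : ZMod N) = 0) : γ ∈ Gamma1 N := by
  rw [Gamma1_mem]
  refine ⟨h00, ?_, h10⟩
  have hdet := Matrix.det_fin_two (γ : Matrix (Fin 2) (Fin 2) ℤ)
  rw [γ.det_coe] at hdet
  have := congrArg (Int.cast : ℤ → ZMod N) hdet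
  push_cast at this
  rw [h00, h10] at this
  simpa using this.symm

/-- Elements of `Γ₁(N) · diag(1,p) · Γ₁(N)` have determinant `p` and reduce to `(1 *; 0 p)`
modulo `N` (Diamond–Shurman §5.2, (5.3)). [cite: DiamondShurman2005, §5.2] -/
theorem gamma1_mul_diag_mul_gamma1 {g₁ g₂ : SL(2, ℤ)} (h₁ : g₁ ∈ Gamma1 N) (h₂ : g₂ ∈ Gamma1 N)
    (p : ℤ) :
    ((g₁ : Matrix (Fin 2) (Fin 2) ℤ) * !![1, 0; 0, p] * g₂).det = p ∧
    ((((g₁ : Matrix (Fin 2) (Fin 2) ℤ) * !![1, 0; 0, p] * g₂) 0 0 : ℤ) : ZMod N) = 1 ∧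
    ((((g₁ : Matrix (Fin 2) (Fin 2) ℤ) * !![1, 0; 0, p] * g₂) 1 0 : ℤ) : ZMod N) = 0 := by
  rw [Gamma1_mem] at h₁ h₂
  refine ⟨by simp [Matrix.det_fin_two_of], ?_, ?_⟩
  · simp only [Matrix.mul_apply, Fin.sum_univ_two, Matrix.of_apply, Matrix.cons_val',
      Matrix.cons_val_zero, Matrix.cons_val_one, Matrix.empty_val', Matrix.cons_val_fin_one]
    push_cast
    simp [h₁.1, h₂.1, h₂.2.2]
  · simp only [Matrix.mul_apply, Fin.sum_univ_two, Matrix.of_apply, Matrix.cons_val',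
      Matrix.cons_val_zero, Matrix.cons_val_one, Matrix.empty_val', Matrix.cons_val_fin_one]
    push_cast
    simp [h₁.2.2, h₁.2.1, h₂.1, h₂.2.2]

/-- Conjugating `diag(1,p)` by `σ ∈ Γ₀(N)` gives a matrix of determinant `p` reducing to
`(1 *; 0 p)` modulo `N` (Diamond–Shurman §5.2, proof of Prop. 5.2.4(a)).
[cite: DiamondShurman2005, §5.2] -/
theorem gamma0_conj_diag {σ : SL(2, ℤ)} (hσ : σ ∈ Gamma0 N) (p : ℤ) :
    ((σ : Matrix (Fin 2) (Fin 2) ℤ) * !![1, 0; 0, p] * (σ⁻¹ : SL(2, ℤ))).det = p ∧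
    ((((σ : Matrix (Fin 2) (Fin 2) ℤ) * !![1, 0; 0, p] * (σ⁻¹ : SL(2, ℤ))) 0 0 : ℤ) : ZMod N) = 1 ∧
    ((((σ : Matrix (Fin 2) (Fin 2) ℤ) * !![1, 0; 0, p] * (σ⁻¹ : SL(2, ℤ))) 1 0 : ℤ)
        : ZMod N) = 0 := by
  rw [Gamma0_mem] at hσ
  have hdet := Matrix.det_fin_two (σ : Matrix (Fin 2) (Fin 2) ℤ)
  rw [σ.det_coe] at hdet
  have hdet' := congrArg (Int.cast : ℤ → ZMod N) hdet
  push_cast at hdet'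
  rw [hσ] at hdet'
  refine ⟨?_, ?_, ?_⟩
  · rw [Matrix.det_mul, Matrix.det_mul, σ.det_coe, (σ⁻¹).det_coe]
    simp [Matrix.det_fin_two_of]
  · simp only [Matrix.SpecialLinearGroup.coe_inv, Matrix.adjugate_fin_two, Matrix.mul_apply,
      Fin.sum_univ_two, Matrix.of_apply, Matrix.cons_val', Matrix.cons_val_zero,
          Matrix.cons_val_one,
      Matrix.empty_val', Matrix.cons_val_fin_one]
    push_cast
    simp only [hσ, mul_zero, add_zero, mul_one, neg_zero]
    linear_combination -hdet'
  · simp only [Matrix.SpecialLinearGroup.coe_inv, Matrix.adjugate_fin_two, Matrix.mul_apply,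
      Fin.sum_univ_two, Matrix.of_apply, Matrix.cons_val', Matrix.cons_val_zero,
          Matrix.cons_val_one,
      Matrix.empty_val', Matrix.cons_val_fin_one]
    push_cast
    simp [hσ]

/-- `σ · diag(p, 1)` for `σ ∈ Γ₀(N)` with lower-right entry `≡ p (mod N)` has determinant `p` and
reduces to `(1 *; 0 p)` modulo `N` (this is Diamond–Shurman's `β_∞`, (5.2)).
[cite: DiamondShurman2005, (5.2)] -/
theorem gamma0_mul_diag' {σ : SL(2, ℤ)} (hσ : σ ∈ Gamma0 N) (p : ℤ)
    (hσp : ((σ 1 1 : ℤ) : ZMod N) = p) :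
    ((σ : Matrix (Fin 2) (Fin 2) ℤ) * !![p, 0; 0, 1]).det = p ∧
    ((((σ : Matrix (Fin 2) (Fin 2) ℤ) * !![p, 0; 0, 1]) 0 0 : ℤ) : ZMod N) = 1 ∧
    ((((σ : Matrix (Fin 2) (Fin 2) ℤ) * !![p, 0; 0, 1]) 1 0 : ℤ) : ZMod N) = 0 := by
  rw [Gamma0_mem] at hσ
  have hdet := Matrix.det_fin_two (σ : Matrix (Fin 2) (Fin 2) ℤ)
  rw [σ.det_coe] at hdet
  have hdet' := congrArg (Int.cast : ℤ → ZMod N) hdet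
  push_cast at hdet'
  rw [hσ, hσp] at hdet'
  refine ⟨by simp [Matrix.det_fin_two_of], ?_, ?_⟩
  · simp only [Matrix.mul_apply, Fin.sum_univ_two, Matrix.of_apply, Matrix.cons_val',
      Matrix.cons_val_zero, Matrix.cons_val_one, Matrix.empty_val', Matrix.cons_val_fin_one]
    push_cast
    simp only [mul_zero, add_zero]
    linear_combination -hdet'
  · simp only [Matrix.mul_apply, Fin.sum_univ_two, Matrix.of_apply, Matrix.cons_val',
      Matrix.cons_val_zero, Matrix.cons_val_one, Matrix.empty_val', Matrix.cons_val_fin_one]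
    push_cast
    simp [hσ]

/-- **Coset decomposition, finite part** (Diamond–Shurman (5.2)/(5.3)): an integer matrix `A` of
prime determinant `p` with `A ≡ (1 *; 0 *) (mod N)`, whose first column is not divisible by `p`,
lies in `Γ₁(N) β_j` with `β_j = (1 j; 0 p)` for some `0 ≤ j < p`.
[cite: DiamondShurman2005, (5.2) and Prop. 5.2.1] -/
theorem exists_gamma1_mul_beta (hp : p.Prime) (A : Matrix (Fin 2) (Fin 2) ℤ) (hdet : A.det = p)
    (h00 : ((A 0 0 : ℤ) : ZMod N) = 1) (h10 : ((A 1 0 : ℤ) : ZMod N) = 0)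
    (h : ¬ ((p : ℤ) ∣ A 0 0 ∧ (p : ℤ) ∣ A 1 0)) :
    ∃ j : ℕ, j < p ∧ ∃ γ : SL(2, ℤ), γ ∈ Gamma1 N ∧
      A = (γ : Matrix (Fin 2) (Fin 2) ℤ) * !![1, (j : ℤ); 0, (p : ℤ)] := by
  haveI := Fact.mk hp
  have hdet' : A 0 0 * A 1 1 - A 0 1 * A 1 0 = p := by rw [← hdet, Matrix.det_fin_two]
  have hdetp : (A 0 0 : ZMod p) * A 1 1 - A 0 1 * A 1 0 = 0 := by
    have := congrArg (Int.cast : ℤ → ZMod p) hdet'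
    push_cast at this
    rw [this, ZMod.natCast_self]
  -- find `j` with `p ∣ A 0 1 - j * A 0 0` and `p ∣ A 1 1 - j * A 1 0`
  obtain ⟨j, hj, h1, h2⟩ : ∃ j : ℕ, j < p ∧ (p : ℤ) ∣ A 0 1 - j * A 0 0 ∧
      (p : ℤ) ∣ A 1 1 - j * A 1 0 := by
    by_cases ha : (p : ℤ) ∣ A 0 0
    · have hc : ((A 1 0 : ℤ) : ZMod p) ≠ 0 := by
        rw [Ne, ZMod.intCast_zmod_eq_zero_iff_dvd]
        exact fun hc ↦ h ⟨ha, hc⟩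
      have ha' : ((A 0 0 : ℤ) : ZMod p) = 0 := by rwa [ZMod.intCast_zmod_eq_zero_iff_dvd]
      refine ⟨((A 1 1 : ZMod p) * (A 1 0 : ZMod p)⁻¹).val, ZMod.val_lt _, ?_, ?_⟩
      · rw [← ZMod.intCast_zmod_eq_zero_iff_dvd]
        push_cast
        rw [ZMod.natCast_zmod_val, ha', mul_zero, sub_zero]
        rw [ha', zero_mul, zero_sub, neg_eq_zero, mul_eq_zero] at hdetp
        exact hdetp.resolve_right hc
      · rw [← ZMod.intCast_zmod_eq_zero_iff_dvd]
        push_cast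
        rw [ZMod.natCast_zmod_val, inv_mul_cancel_right₀ hc, sub_self]
    · have ha' : ((A 0 0 : ℤ) : ZMod p) ≠ 0 := by
        rwa [Ne, ZMod.intCast_zmod_eq_zero_iff_dvd]
      refine ⟨((A 0 1 : ZMod p) * (A 0 0 : ZMod p)⁻¹).val, ZMod.val_lt _, ?_, ?_⟩
      · rw [← ZMod.intCast_zmod_eq_zero_iff_dvd]
        push_cast
        rw [ZMod.natCast_zmod_val, inv_mul_cancel_right₀ ha', sub_self]
      · rw [← ZMod.intCast_zmod_eq_zero_iff_dvd]
        push_cast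
        rw [ZMod.natCast_zmod_val]
        field_simp
        linear_combination hdetp
  obtain ⟨e, he⟩ := h1
  obtain ⟨e', he'⟩ := h2
  have hp0 : (p : ℤ) ≠ 0 := by exact_mod_cast hp.ne_zero
  -- the matrix `γ = A β_j⁻¹`
  have hγdet : Matrix.det !![A 0 0, e; A 1 0, e'] = 1 := by
    rw [Matrix.det_fin_two_of]
    apply mul_left_cancel₀ hp0
    linear_combination hdet' + A 1 0 * he - A 0 0 * he'
  refine ⟨j, hj, ⟨_, hγdet⟩, mem_Gamma1_of_col (by simpa using h00) (by simpa using h10), ?_⟩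
  ext i j'
  fin_cases i <;> fin_cases j'
  · simp
  · simp [Matrix.mul_apply, Fin.sum_univ_two]
    linear_combination he
  · simp
  · simp [Matrix.mul_apply, Fin.sum_univ_two]
    linear_combination he'

/-- If `p ∣ N`, no matrix `A ≡ (1 *; 0 *) (mod N)` has `p ∣ A 0 0`. [folklore] -/
theorem not_dvd_of_dvd_level (hp : p.Prime) (hpN : p ∣ N) (A : Matrix (Fin 2) (Fin 2) ℤ)
    (h00 : ((A 0 0 : ℤ) : ZMod N) = 1) : ¬ ((p : ℤ) ∣ A 0 0 ∧ (p : ℤ) ∣ A 1 0) := by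
  rintro ⟨ha, -⟩
  have h1 : (N : ℤ) ∣ A 0 0 - 1 := by
    rw [← ZMod.intCast_zmod_eq_zero_iff_dvd]
    push_cast
    rw [h00, sub_self]
  have h2 : (p : ℤ) ∣ 1 := by
    have := dvd_sub ha ((Int.natCast_dvd_natCast.mpr hpN).trans h1)
    simpa using this
  exact hp.ne_one (by exact_mod_cast Int.eq_one_of_dvd_one (by positivity) h2)

/-- **Coset decomposition, the coset of `β_∞`** (Diamond–Shurman (5.2)): an integer matrix `A` of
prime determinant `p` with `A ≡ (1 *; 0 *) (mod N)` whose first column is divisible by `p` lies in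
`Γ₁(N) σ diag(p, 1)` for every `σ ∈ Γ₀(N)` with lower-right entry `≡ p (mod N)`; moreover then
`p ∤ N`. [cite: DiamondShurman2005, (5.2) and Prop. 5.2.1] -/
theorem exists_gamma1_mul_beta_inf (hp : p.Prime) (A : Matrix (Fin 2) (Fin 2) ℤ) (hdet : A.det = p)
    (h00 : ((A 0 0 : ℤ) : ZMod N) = 1) (h10 : ((A 1 0 : ℤ) : ZMod N) = 0)
    (ha : (p : ℤ) ∣ A 0 0) (hc : (p : ℤ) ∣ A 1 0) {σ : SL(2, ℤ)} (hσ : σ ∈ Gamma0 N)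
    (hσp : ((σ 1 1 : ℤ) : ZMod N) = p) :
    ∃ γ : SL(2, ℤ), γ ∈ Gamma1 N ∧
      A = (γ : Matrix (Fin 2) (Fin 2) ℤ)
          * ((σ : Matrix (Fin 2) (Fin 2) ℤ) * !![(p : ℤ), 0; 0, 1]) := by
  obtain ⟨a', ha'⟩ := ha
  obtain ⟨c', hc'⟩ := hc
  have hp0 : (p : ℤ) ≠ 0 := by exact_mod_cast hp.ne_zero
  have hdet' : A 0 0 * A 1 1 - A 0 1 * A 1 0 = p := by rw [← hdet, Matrix.det_fin_two]
  have hA'det : Matrix.det !![a', A 0 1; c', A 1 1] = 1 := by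
    rw [Matrix.det_fin_two_of]
    apply mul_left_cancel₀ hp0
    linear_combination hdet' - A 1 1 * ha' + A 0 1 * hc'
  rw [Gamma0_mem] at hσ
  refine ⟨⟨_, hA'det⟩ * σ⁻¹, mem_Gamma1_of_col ?_ ?_, ?_⟩
  · simp only [Matrix.SpecialLinearGroup.coe_mul, Matrix.SpecialLinearGroup.coe_inv,
      Matrix.adjugate_fin_two, Matrix.mul_apply, Fin.sum_univ_two, Matrix.of_apply,
          Matrix.cons_val',
      Matrix.cons_val_zero, Matrix.cons_val_one, Matrix.empty_val', Matrix.cons_val_fin_one]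
    push_cast
    rw [hσ, hσp, ← h00, ha']
    push_cast
    ring
  · simp only [Matrix.SpecialLinearGroup.coe_mul, Matrix.SpecialLinearGroup.coe_inv,
      Matrix.adjugate_fin_two, Matrix.mul_apply, Fin.sum_univ_two, Matrix.of_apply,
          Matrix.cons_val',
      Matrix.cons_val_zero, Matrix.cons_val_one, Matrix.empty_val', Matrix.cons_val_fin_one]
    push_cast
    rw [hσ, hσp, neg_zero, mul_zero, add_zero]
    have : ((c' : ℤ) : ZMod N) * p = A 1 0 := by rw [hc']; push_cast; ring
    rw [this, h10]
  · have hA : A = !![a', A 0 1; c', A 1 1] * !![(p : ℤ), 0; 0, 1] := by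
      ext i j
      fin_cases i <;> fin_cases j
      · simp [Matrix.mul_apply, Fin.sum_univ_two, ha', mul_comm]
      · simp [Matrix.mul_apply, Fin.sum_univ_two]
      · simp [Matrix.mul_apply, Fin.sum_univ_two, hc', mul_comm]
      · simp [Matrix.mul_apply, Fin.sum_univ_two]
    have hσσ : ((σ⁻¹ : SL(2, ℤ)) : Matrix (Fin 2) (Fin 2) ℤ)
        * (σ : Matrix (Fin 2) (Fin 2) ℤ) = 1 := by
      rw [← Matrix.SpecialLinearGroup.coe_mul, inv_mul_cancel, Matrix.SpecialLinearGroup.coe_one]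
    rw [Matrix.SpecialLinearGroup.coe_mul, Matrix.mul_assoc,
        ← Matrix.mul_assoc _ (σ : Matrix (Fin 2) (Fin 2) ℤ),
      hσσ, Matrix.one_mul]
    conv_lhs => rw [hA]

/-- In the situation of `exists_gamma1_mul_beta_inf`, `p ∤ N`. [folklore] -/
theorem not_dvd_level (hp : p.Prime) (A : Matrix (Fin 2) (Fin 2) ℤ)
    (h00 : ((A 0 0 : ℤ) : ZMod N) = 1) (ha : (p : ℤ) ∣ A 0 0) (hc : (p : ℤ) ∣ A 1 0) : ¬ p ∣ N :=
  fun hpN ↦ not_dvd_of_dvd_level hp hpN A h00 ⟨ha, hc⟩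

/-- For `p ∤ N` there is `σ ∈ Γ₀(N)` with lower-right entry `≡ p (mod N)`, namely
`σ = (m n; N p)` with `mp - nN = 1` (Diamond–Shurman (5.2)). [cite: DiamondShurman2005, (5.2)] -/
theorem exists_gamma0_entry_eq (hp : p.Prime) (hpN : ¬ p ∣ N) :
    ∃ σ : SL(2, ℤ), σ ∈ Gamma0 N ∧ ((σ 1 1 : ℤ) : ZMod N) = p ∧ (σ 1 0 : ℤ) = N
        ∧ (σ 1 1 : ℤ) = p := by
  have hcop : Int.gcd (p : ℤ) (N : ℤ) = 1 := by
    rw [Int.gcd_natCast_natCast]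
    exact hp.coprime_iff_not_dvd.mpr hpN
  have hbez := Int.gcd_eq_gcd_ab (p : ℤ) (N : ℤ)
  rw [hcop, Nat.cast_one] at hbez
  have hdet : Matrix.det !![Int.gcdA p N, -Int.gcdB p N; (N : ℤ), (p : ℤ)] = 1 := by
    rw [Matrix.det_fin_two_of]
    linear_combination -hbez
  refine ⟨⟨_, hdet⟩, ?_, ?_, ?_, ?_⟩
  · simp [Gamma0_mem]
  · simp
  · simp
  · simp

/-- `σ diag(p,1) ∈ Γ₁(N) diag(1,p) Γ₁(N)` (as integer matrices) for `σ ∈ Γ₀(N)` with lower-right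
entry `≡ p (mod N)`, `p ∤ N` (Diamond–Shurman §5.2: `β_∞` lies in the double coset).
[cite: DiamondShurman2005, §5.2] -/
theorem gamma0_mul_diag'_mem (hp : p.Prime) (hpN : ¬ p ∣ N) {σ : SL(2, ℤ)} (hσ : σ ∈ Gamma0 N)
    (hσp : ((σ 1 1 : ℤ) : ZMod N) = p) :
    ∃ g₁ g₂ : SL(2, ℤ), g₁ ∈ Gamma1 N ∧ g₂ ∈ Gamma1 N ∧
      (σ : Matrix (Fin 2) (Fin 2) ℤ) * !![(p : ℤ), 0; 0, 1] =
        (g₁ : Matrix (Fin 2) (Fin 2) ℤ) * !![1, 0; 0, (p : ℤ)] * g₂ := by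
  obtain ⟨σ₀, hσ₀, hσ₀p, h10, h11⟩ := exists_gamma0_entry_eq hp hpN
  -- write `m = σ₀ 0 0`, `n = σ₀ 0 1`, so `m p - n N = 1`.
  have hbez : (σ₀ 0 0 : ℤ) * p - σ₀ 0 1 * N = 1 := by
    have := Matrix.det_fin_two (σ₀ : Matrix (Fin 2) (Fin 2) ℤ)
    rw [σ₀.det_coe, h10, h11] at this
    linear_combination -this
  have hτ₁ : Matrix.det !![(1 : ℤ), 0; N * p, 1] = 1 := by simp [Matrix.det_fin_two_of]
  have hτ₂ : Matrix.det !![(σ₀ 0 0 : ℤ) * p, σ₀ 0 1; N * (1 - σ₀ 0 0 * p), 1 - σ₀ 0 1 * N] = 1 := by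
    rw [Matrix.det_fin_two_of]; linear_combination hbez
  -- `σ = (σ σ₀⁻¹) σ₀` with `σ σ₀⁻¹ ∈ Γ₁(N)`
  have hmem : σ * σ₀⁻¹ ∈ Gamma1 N := by
    rw [Gamma0_mem] at hσ
    have hdσ := Matrix.det_fin_two (σ : Matrix (Fin 2) (Fin 2) ℤ)
    rw [σ.det_coe] at hdσ
    have hdσ' := congrArg (Int.cast : ℤ → ZMod N) hdσ
    push_cast at hdσ'
    rw [hσ, hσp] at hdσ'
    apply mem_Gamma1_of_col
    · simp only [Matrix.SpecialLinearGroup.coe_mul, Matrix.SpecialLinearGroup.coe_inv,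
        Matrix.adjugate_fin_two, Matrix.mul_apply, Fin.sum_univ_two, Matrix.of_apply,
            Matrix.cons_val',
        Matrix.cons_val_zero, Matrix.cons_val_one, Matrix.empty_val',
            Matrix.cons_val_fin_one, h10, h11]
      push_cast
      rw [ZMod.natCast_self]
      linear_combination -hdσ'
    · simp only [Matrix.SpecialLinearGroup.coe_mul, Matrix.SpecialLinearGroup.coe_inv,
        Matrix.adjugate_fin_two, Matrix.mul_apply, Fin.sum_univ_two, Matrix.of_apply,
            Matrix.cons_val',
        Matrix.cons_val_zero, Matrix.cons_val_one, Matrix.empty_val',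
            Matrix.cons_val_fin_one, h10, h11]
      push_cast
      rw [ZMod.natCast_self, hσ]
      ring
  refine ⟨σ * σ₀⁻¹ * ⟨_, hτ₁⟩, ⟨_, hτ₂⟩, Subgroup.mul_mem _ hmem (mem_Gamma1_of_col (by simp) ?_),
    mem_Gamma1_of_col ?_ (by simp), ?_⟩
  · simp
  · simp only [Matrix.of_apply, Matrix.cons_val', Matrix.cons_val_zero, Matrix.empty_val',
      Matrix.cons_val_fin_one]
    have := congrArg (Int.cast : ℤ → ZMod N) hbez
    push_cast at this ⊢
    linear_combination this + ((σ₀ 0 1 : ℤ) : ZMod N) * ZMod.natCast_self N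
  · have key : (σ₀ : Matrix (Fin 2) (Fin 2) ℤ) * !![(p : ℤ), 0; 0, 1] =
        !![(1 : ℤ), 0; N * p, 1] * !![1, 0; 0, (p : ℤ)] *
          !![(σ₀ 0 0 : ℤ) * p, σ₀ 0 1; N * (1 - σ₀ 0 0 * p), 1 - σ₀ 0 1 * N] := by
      ext i j
      fin_cases i <;> fin_cases j <;>
        simp [Matrix.mul_apply, Fin.sum_univ_two, h10, h11] <;> ring
    have hσσ : ((σ₀⁻¹ : SL(2, ℤ)) : Matrix (Fin 2) (Fin 2) ℤ)
        * (σ₀ : Matrix (Fin 2) (Fin 2) ℤ) = 1 := by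
      rw [← Matrix.SpecialLinearGroup.coe_mul, inv_mul_cancel, Matrix.SpecialLinearGroup.coe_one]
    symm
    calc ((σ * σ₀⁻¹ * ⟨_, hτ₁⟩ : SL(2, ℤ)) : Matrix (Fin 2) (Fin 2) ℤ) * !![1, 0; 0, (p : ℤ)] *
          ((⟨_, hτ₂⟩ : SL(2, ℤ)) : Matrix (Fin 2) (Fin 2) ℤ)
        = (σ : Matrix (Fin 2) (Fin 2) ℤ) * (((σ₀⁻¹ : SL(2, ℤ)) : Matrix (Fin 2) (Fin 2) ℤ) *
            (!![(1 : ℤ), 0; N * p, 1] * !![1, 0; 0, (p : ℤ)] *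
              !![(σ₀ 0 0 : ℤ) * p, σ₀ 0 1; N * (1 - σ₀ 0 0 * p), 1 - σ₀ 0 1 * N])) := by
          simp only [Matrix.SpecialLinearGroup.coe_mul, Matrix.mul_assoc]
      _ = (σ : Matrix (Fin 2) (Fin 2) ℤ) * !![(p : ℤ), 0; 0, 1] := by
          rw [← key, ← Matrix.mul_assoc _ (σ₀ : Matrix (Fin 2) (Fin 2) ℤ), hσσ, Matrix.one_mul]

end IntMatrices

/-! ### Transport to `GL(2, ℝ)`: coset representatives for `Γ₁(N) diag(1,p) Γ₁(N)` -/

section Real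

/-! Throughout this section, `glCast (diagGL 1 p _ _)` is `diag(1, p) ∈ GL(2, ℝ)` (the matrix
defining `heckeT _ k p`), `glCast (diagGL p 1 _ _)` is `diag(p, 1)`,
`(Gamma1 N : Subgroup (GL (Fin 2) ℝ))` is the image of `Γ₁(N)` in `GL(2, ℝ)`, and
`((ModularGroup.T ^ j : SL(2, ℤ)) : GL (Fin 2) ℝ)` is the image of `T ^ j = (1 j; 0 1)`, so that
`β_j = diag(1, p) T ^ j = (1 j; 0 p)` (Diamond–Shurman (5.2)). -/

variable {N : ℕ} {p : ℕ}

/-- Mathlib's `mapGL ℝ γ` is the coercion `(γ : GL(2, ℝ))` (definitionally). [folklore] -/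
theorem mapGL_eq_coe (γ : SL(2, ℤ)) : Matrix.SpecialLinearGroup.mapGL ℝ γ = (γ : GL (Fin 2) ℝ) :=
  rfl

/-- Underlying real matrix of `diag(1, p)`. [folklore] -/
theorem coe_glCast_diagGL_one [NeZero p] :
    ((glCast (diagGL 1 p one_pos (Nat.cast_pos.mpr (NeZero.pos p)))) : Matrix (Fin 2) (Fin 2) ℝ) =
      (!![(1 : ℤ), 0; 0, (p : ℤ)]).map (Int.cast : ℤ → ℝ) := by
  ext i j; fin_cases i <;> fin_cases j <;> simp [glCast, diagGL]

/-- Underlying real matrix of `diag(p, 1)`. [folklore] -/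
theorem coe_glCast_diagGL_one' [NeZero p] :
    ((glCast (diagGL p 1 (Nat.cast_pos.mpr (NeZero.pos p)) one_pos)) : Matrix (Fin 2) (Fin 2) ℝ) =
      (!![(p : ℤ), 0; 0, 1]).map (Int.cast : ℤ → ℝ) := by
  ext i j; fin_cases i <;> fin_cases j <;> simp [glCast, diagGL]

/-- Underlying real matrix of the image of `γ ∈ SL(2, ℤ)`: this is `val_mapGL'` of
`HeckeOperatorsProofs.lean`, restated for the coercion `(γ : GL (Fin 2) ℝ)`, which elaborates to
`toGL (map (Int.castRingHom ℝ) γ)` rather than the definitionally equal `mapGL ℝ γ`, so that `rw`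
can use it on such terms. [folklore] -/
theorem coe_SL_GL (γ : SL(2, ℤ)) :
    ((γ : GL (Fin 2) ℝ) : Matrix (Fin 2) (Fin 2) ℝ) =
      (γ : Matrix (Fin 2) (Fin 2) ℤ).map (Int.cast : ℤ → ℝ) :=
  val_mapGL' γ

/-- `T ^ j = (1 j; 0 1)`. [folklore] -/
theorem coe_T_pow (j : ℕ) :
    ((ModularGroup.T ^ j : SL(2, ℤ)) : Matrix (Fin 2) (Fin 2) ℤ) = !![1, (j : ℤ); 0, 1] := by
  rw [← zpow_natCast, ModularGroup.coe_T_zpow]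

/-- `T ^ j ∈ Γ₁(N)`. [folklore] -/
theorem T_pow_mem_Gamma1 (j : ℕ) : ModularGroup.T ^ j ∈ Gamma1 N := by
  rw [Gamma1_mem, coe_T_pow]
  simp

/-- Underlying real matrix of `β_j = diag(1,p) T^j = (1 j; 0 p)`. [folklore] -/
theorem coe_beta [NeZero p] (j : ℕ) :
    (((glCast (diagGL 1 p one_pos (Nat.cast_pos.mpr (NeZero.pos p))))
        * ((ModularGroup.T ^ (j : ℕ) : SL(2, ℤ)) : GL (Fin 2) ℝ) : GL (Fin 2) ℝ)
        : Matrix (Fin 2) (Fin 2) ℝ) =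
      (!![(1 : ℤ), j; 0, (p : ℤ)]).map (Int.cast : ℤ → ℝ) := by
  rw [Matrix.GeneralLinearGroup.coe_mul, coe_glCast_diagGL_one, coe_SL_GL,
      ← Matrix.map_mul_intCast, coe_T_pow]
  congr 1
  simp

/-- Two elements of `GL(2, ℝ)` with integral matrices are equal if the integer matrices are.
[folklore] -/
theorem GL_eq_of_map_eq {x y : GL (Fin 2) ℝ} {A B : Matrix (Fin 2) (Fin 2) ℤ}
    (hx : (x : Matrix (Fin 2) (Fin 2) ℝ) = A.map (Int.cast : ℤ → ℝ))
    (hy : (y : Matrix (Fin 2) (Fin 2) ℝ) = B.map (Int.cast : ℤ → ℝ)) (h : A = B) : x = y := by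
  subst h
  exact Matrix.GeneralLinearGroup.ext fun i j ↦ by rw [hx, hy]

/-- If `x = γ y` in `GL(2, ℝ)` with `x, y` integral and `γ ∈ SL(2, ℤ)`, the same holds for the
integer matrices. [folklore] -/
theorem int_eq_of_GL_eq {x y : GL (Fin 2) ℝ} {A B : Matrix (Fin 2) (Fin 2) ℤ} {γ : SL(2, ℤ)}
    (hx : (x : Matrix (Fin 2) (Fin 2) ℝ) = A.map (Int.cast : ℤ → ℝ))
    (hy : (y : Matrix (Fin 2) (Fin 2) ℝ) = B.map (Int.cast : ℤ → ℝ)) (h : x * y⁻¹ = γ) :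
    A = (γ : Matrix (Fin 2) (Fin 2) ℤ) * B := by
  rw [mul_inv_eq_iff_eq_mul] at h
  apply Matrix.map_injective (Int.cast_injective (α := ℝ))
  change A.map _ = ((γ : Matrix (Fin 2) (Fin 2) ℤ) * B).map (Int.cast : ℤ → ℝ)
  rw [← hx, h, Matrix.GeneralLinearGroup.coe_mul, Matrix.map_mul_intCast, coe_SL_GL, hy]

/-- If `x a⁻¹, x b⁻¹ ∈ Γ` then `a b⁻¹ ∈ Γ`. [folklore] -/
theorem mul_inv_mem_of_mul_inv_mem {G : Type*} [Group G] {Γ : Subgroup G} {x a b : G}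
    (ha : x * a⁻¹ ∈ Γ) (hb : x * b⁻¹ ∈ Γ) : a * b⁻¹ ∈ Γ := by
  have := Γ.mul_mem (Γ.inv_mem ha) hb
  simpa [mul_assoc] using this

/-- If `A = γ B` with `γ ∈ Γ₁(N)` then `x y⁻¹ ∈ Γ₁(N)` for the corresponding elements of
`GL(2, ℝ)`. [folklore] -/
theorem mul_inv_mem_of_int {x y : GL (Fin 2) ℝ} {A B : Matrix (Fin 2) (Fin 2) ℤ} {γ : SL(2, ℤ)}
    (hx : (x : Matrix (Fin 2) (Fin 2) ℝ) = A.map (Int.cast : ℤ → ℝ))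
    (hy : (y : Matrix (Fin 2) (Fin 2) ℝ) = B.map (Int.cast : ℤ → ℝ)) (hγ : γ ∈ Gamma1 N)
    (h : A = (γ : Matrix (Fin 2) (Fin 2) ℤ) * B) : x * y⁻¹
        ∈ (Gamma1 N : Subgroup (GL (Fin 2) ℝ)) := by
  have : x * y⁻¹ = (γ : GL (Fin 2) ℝ) := by
    rw [mul_inv_eq_iff_eq_mul]
    refine GL_eq_of_map_eq hx ?_ h
    rw [Matrix.GeneralLinearGroup.coe_mul, Matrix.map_mul_intCast, coe_SL_GL, hy]
  rw [this]
  exact Subgroup.mem_map_of_mem _ hγ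

/-- Elements of `Γ₁(N) diag(1,p) Γ₁(N) ⊆ GL(2, ℝ)` are (images of) integer matrices of determinant
`p` congruent to `(1 *; 0 *)` modulo `N` (Diamond–Shurman (5.3)).
[cite: DiamondShurman2005, §5.2] -/
theorem exists_int_of_mem_doubleCoset [NeZero p] {x : GL (Fin 2) ℝ}
    (hx : x ∈ DoubleCoset.doubleCoset
        (glCast (diagGL 1 p one_pos (Nat.cast_pos.mpr (NeZero.pos p))))
        ((Gamma1 N : Subgroup (GL (Fin 2) ℝ)) : Set (GL (Fin 2) ℝ))
        (Gamma1 N : Subgroup (GL (Fin 2) ℝ))) :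
    ∃ A : Matrix (Fin 2) (Fin 2) ℤ, (x : Matrix (Fin 2) (Fin 2) ℝ) = A.map (Int.cast : ℤ → ℝ) ∧
      A.det = p ∧ ((A 0 0 : ℤ) : ZMod N) = 1 ∧ ((A 1 0 : ℤ) : ZMod N) = 0 := by
  obtain ⟨_, ⟨g₁, h₁, rfl⟩, _, ⟨g₂, h₂, rfl⟩, rfl⟩ := DoubleCoset.mem_doubleCoset.mp hx
  refine ⟨(g₁ : Matrix (Fin 2) (Fin 2) ℤ) * !![1, 0; 0, (p : ℤ)] * g₂, ?_,
    gamma1_mul_diag_mul_gamma1 h₁ h₂ p⟩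
  rw [Matrix.GeneralLinearGroup.coe_mul, Matrix.GeneralLinearGroup.coe_mul, Matrix.map_mul_intCast,
    Matrix.map_mul_intCast, mapGL_eq_coe, mapGL_eq_coe, coe_SL_GL, coe_SL_GL, coe_glCast_diagGL_one]

/-- Conversely, every integer matrix of determinant `p` congruent to `(1 *; 0 *)` modulo `N` lies
in `Γ₁(N) diag(1,p) Γ₁(N)` (Diamond–Shurman (5.3), via the explicit representatives (5.2)).
[cite: DiamondShurman2005, §5.2] -/
theorem mem_doubleCoset_of_int (hp : p.Prime) [NeZero p] {x : GL (Fin 2) ℝ}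
    {A : Matrix (Fin 2) (Fin 2) ℤ} (hx : (x : Matrix (Fin 2) (Fin 2) ℝ) = A.map (Int.cast : ℤ → ℝ))
    (hdet : A.det = p) (h00 : ((A 0 0 : ℤ) : ZMod N) = 1) (h10 : ((A 1 0 : ℤ) : ZMod N) = 0) :
    x ∈ DoubleCoset.doubleCoset (glCast (diagGL 1 p one_pos (Nat.cast_pos.mpr (NeZero.pos p))))
        ((Gamma1 N : Subgroup (GL (Fin 2) ℝ)) : Set (GL (Fin 2) ℝ))
        (Gamma1 N : Subgroup (GL (Fin 2) ℝ)) := by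
  obtain ⟨g₁, g₂, hg₁, hg₂, hA⟩ : ∃ g₁ g₂ : SL(2, ℤ), g₁ ∈ Gamma1 N ∧ g₂ ∈ Gamma1 N ∧
      A = (g₁ : Matrix (Fin 2) (Fin 2) ℤ) * !![1, 0; 0, (p : ℤ)] * g₂ := by
    by_cases h : (p : ℤ) ∣ A 0 0 ∧ (p : ℤ) ∣ A 1 0
    · have hpN := not_dvd_level hp A h00 h.1 h.2
      obtain ⟨σ, hσ, hσp, -⟩ := exists_gamma0_entry_eq hp hpN
      obtain ⟨γ, hγ, hAγ⟩ := exists_gamma1_mul_beta_inf hp A hdet h00 h10 h.1 h.2 hσ hσp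
      obtain ⟨g₁, g₂, hg₁, hg₂, hσeq⟩ := gamma0_mul_diag'_mem hp hpN hσ hσp
      refine ⟨γ * g₁, g₂, mul_mem hγ hg₁, hg₂, ?_⟩
      rw [hAγ, hσeq, Matrix.SpecialLinearGroup.coe_mul]
      simp only [Matrix.mul_assoc]
    · obtain ⟨j, -, γ, hγ, hAγ⟩ := exists_gamma1_mul_beta hp A hdet h00 h10 h
      refine ⟨γ, ModularGroup.T ^ j, hγ, T_pow_mem_Gamma1 j, ?_⟩
      rw [hAγ, Matrix.mul_assoc, coe_T_pow]
      congr 1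
      simp
  refine DoubleCoset.mem_doubleCoset.mpr ⟨g₁, ⟨g₁, hg₁, rfl⟩, g₂, ⟨g₂, hg₂, rfl⟩, ?_⟩
  refine GL_eq_of_map_eq hx ?_ hA
  rw [Matrix.GeneralLinearGroup.coe_mul, Matrix.GeneralLinearGroup.coe_mul, Matrix.map_mul_intCast,
    Matrix.map_mul_intCast, coe_SL_GL, coe_SL_GL, coe_glCast_diagGL_one]

/-- `β_j = diag(1,p) T^j ∈ Γ₁(N) diag(1,p) Γ₁(N)`. [cite: DiamondShurman2005, (5.2)] -/
theorem beta_mem_doubleCoset [NeZero p] (j : ℕ) :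
    ((glCast (diagGL 1 p one_pos (Nat.cast_pos.mpr (NeZero.pos p))))
        * ((ModularGroup.T ^ (j : ℕ) : SL(2, ℤ)) : GL (Fin 2) ℝ) : GL (Fin 2) ℝ)
        ∈ DoubleCoset.doubleCoset (glCast (diagGL 1 p one_pos (Nat.cast_pos.mpr (NeZero.pos p))))
        ((Gamma1 N : Subgroup (GL (Fin 2) ℝ)) : Set (GL (Fin 2) ℝ))
        (Gamma1 N : Subgroup (GL (Fin 2) ℝ)) :=
  DoubleCoset.mem_doubleCoset.mpr
      ⟨1, Subgroup.one_mem _, ((ModularGroup.T ^ (j : ℕ) : SL(2, ℤ)) : GL (Fin 2) ℝ),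
      ⟨_, T_pow_mem_Gamma1 j, rfl⟩,
    by rw [one_mul]⟩

/-- `β_∞ = σ diag(p, 1) ∈ Γ₁(N) diag(1,p) Γ₁(N)` for `σ ∈ Γ₀(N)` with lower-right entry
`≡ p (mod N)`. [cite: DiamondShurman2005, (5.2)] -/
theorem beta_inf_mem_doubleCoset (hp : p.Prime) [NeZero p] {σ : SL(2, ℤ)} (hσ : σ ∈ Gamma0 N)
    (hσp : ((σ 1 1 : ℤ) : ZMod N) = p) :
    ((σ : GL (Fin 2) ℝ) * (glCast (diagGL p 1 (Nat.cast_pos.mpr (NeZero.pos p)) one_pos))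
        : GL (Fin 2) ℝ) ∈
      DoubleCoset.doubleCoset (glCast (diagGL 1 p one_pos (Nat.cast_pos.mpr (NeZero.pos p))))
          ((Gamma1 N : Subgroup (GL (Fin 2) ℝ)) : Set (GL (Fin 2) ℝ))
          (Gamma1 N : Subgroup (GL (Fin 2) ℝ)) := by
  obtain ⟨hdet, h00, h10⟩ := gamma0_mul_diag' hσ (p : ℤ) (by push_cast; exact hσp)
  refine mem_doubleCoset_of_int hp ?_ hdet h00 h10
  rw [Matrix.GeneralLinearGroup.coe_mul, Matrix.map_mul_intCast, coe_SL_GL, coe_glCast_diagGL_one']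

/-- Disjointness of the cosets `Γ₁(N) β_i`, `0 ≤ i < p` (Diamond–Shurman, proof of Prop. 5.2.1).
[cite: DiamondShurman2005, Prop. 5.2.1] -/
theorem beta_unique [NeZero p] {x : GL (Fin 2) ℝ} {i j : Fin p}
    (hi : x * ((glCast (diagGL 1 p one_pos (Nat.cast_pos.mpr (NeZero.pos p))))
        * ((ModularGroup.T ^ (i : ℕ) : SL(2, ℤ)) : GL (Fin 2) ℝ))⁻¹
        ∈ (Gamma1 N : Subgroup (GL (Fin 2) ℝ)))
        (hj : x * ((glCast (diagGL 1 p one_pos (Nat.cast_pos.mpr (NeZero.pos p))))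
        * ((ModularGroup.T ^ (j : ℕ) : SL(2, ℤ)) : GL (Fin 2) ℝ))⁻¹
        ∈ (Gamma1 N : Subgroup (GL (Fin 2) ℝ))) :
    i = j := by
  obtain ⟨γ, -, hγ⟩ := mul_inv_mem_of_mul_inv_mem hi hj
  have key := int_eq_of_GL_eq (coe_beta (p := p) i) (coe_beta (p := p) j) hγ.symm
  have h00 : (γ 0 0 : ℤ) = 1 := by
    have := congrFun (congrFun key 0) 0
    simpa [Matrix.mul_apply, Fin.sum_univ_two] using this.symm
  have h01 : ((i : ℕ) : ℤ) = (j : ℕ) + γ 0 1 * p := by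
    have := congrFun (congrFun key 0) 1
    simpa [Matrix.mul_apply, Fin.sum_univ_two, h00] using this
  have : ((i : ℕ) : ℤ) = (j : ℕ) := by
    rw [← Int.emod_eq_of_lt (a := ((i : ℕ) : ℤ)) (b := p) (by positivity) (by exact_mod_cast i.2),
      h01, Int.add_mul_emod_self_right,
      Int.emod_eq_of_lt (by positivity) (by exact_mod_cast j.2)]
  exact Fin.ext (by exact_mod_cast this)

/-- The coset `Γ₁(N) β_∞` is disjoint from the `Γ₁(N) β_i` (Diamond–Shurman, proof of
Prop. 5.2.1). [cite: DiamondShurman2005, Prop. 5.2.1] -/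
theorem beta_ne_beta_inf (hp : p.Prime) [NeZero p] {x : GL (Fin 2) ℝ} {i : ℕ} {σ : SL(2, ℤ)}
    (hi : x * ((glCast (diagGL 1 p one_pos (Nat.cast_pos.mpr (NeZero.pos p))))
        * ((ModularGroup.T ^ (i : ℕ) : SL(2, ℤ)) : GL (Fin 2) ℝ))⁻¹
        ∈ (Gamma1 N : Subgroup (GL (Fin 2) ℝ)))
        (hinf : x *
        ((σ : GL (Fin 2) ℝ) * (glCast (diagGL p 1 (Nat.cast_pos.mpr (NeZero.pos p)) one_pos)))⁻¹
        ∈ (Gamma1 N : Subgroup (GL (Fin 2) ℝ))) :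
    False := by
  obtain ⟨γ, -, hγ⟩ := mul_inv_mem_of_mul_inv_mem hi hinf
  have hcoe :
      (((σ : GL (Fin 2) ℝ) * (glCast (diagGL p 1 (Nat.cast_pos.mpr (NeZero.pos p)) one_pos))
      : GL (Fin 2) ℝ) : Matrix (Fin 2) (Fin 2) ℝ) =
      ((σ : Matrix (Fin 2) (Fin 2) ℤ) * !![(p : ℤ), 0; 0, 1]).map (Int.cast : ℤ → ℝ) := by
    rw [Matrix.GeneralLinearGroup.coe_mul, Matrix.map_mul_intCast, coe_SL_GL,
        coe_glCast_diagGL_one']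
  have key := int_eq_of_GL_eq (coe_beta (p := p) i) hcoe hγ.symm
  have h00 : (1 : ℤ) = γ 0 0 * (σ 0 0 * p) + γ 0 1 * (σ 1 0 * p) := by
    have := congrFun (congrFun key 0) 0
    simpa [Matrix.mul_apply, Fin.sum_univ_two] using this
  have : (p : ℤ) ∣ 1 := ⟨γ 0 0 * σ 0 0 + γ 0 1 * σ 1 0, by linear_combination h00⟩
  exact hp.ne_one (by exact_mod_cast Int.eq_one_of_dvd_one (by positivity) this)

/-- **Coset representatives, `p ∣ N`** (Diamond–Shurman (5.2)):
`Γ₁(N) diag(1,p) Γ₁(N) = ⊔_{0 ≤ j < p} Γ₁(N) β_j`.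
[cite: DiamondShurman2005, (5.2) and Prop. 5.2.1] -/
theorem beta_reps_of_dvd (hp : p.Prime) [NeZero p] (hpN : p ∣ N) :
    (∀ i : Fin p,
        ((glCast (diagGL 1 p one_pos (Nat.cast_pos.mpr (NeZero.pos p))))
        * ((ModularGroup.T ^ (i : ℕ) : SL(2, ℤ)) : GL (Fin 2) ℝ) : GL (Fin 2) ℝ) ∈
        DoubleCoset.doubleCoset (glCast (diagGL 1 p one_pos (Nat.cast_pos.mpr (NeZero.pos p))))
            ((Gamma1 N : Subgroup (GL (Fin 2) ℝ)) : Set (GL (Fin 2) ℝ))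
            (Gamma1 N : Subgroup (GL (Fin 2) ℝ))) ∧
    ∀ x ∈ DoubleCoset.doubleCoset (glCast (diagGL 1 p one_pos (Nat.cast_pos.mpr (NeZero.pos p))))
        ((Gamma1 N : Subgroup (GL (Fin 2) ℝ)) : Set (GL (Fin 2) ℝ))
        (Gamma1 N : Subgroup (GL (Fin 2) ℝ)),
      ∃! i : Fin p, x
          * ((glCast (diagGL 1 p one_pos (Nat.cast_pos.mpr (NeZero.pos p))))
          * ((ModularGroup.T ^ (i : ℕ) : SL(2, ℤ)) : GL (Fin 2) ℝ))⁻¹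
          ∈ (Gamma1 N : Subgroup (GL (Fin 2) ℝ)) := by
  refine ⟨fun i ↦ beta_mem_doubleCoset i, fun x hx ↦ ?_⟩
  obtain ⟨A, hxA, hdet, h00, h10⟩ := exists_int_of_mem_doubleCoset hx
  obtain ⟨j, hj, γ, hγ, hAγ⟩ :=
    exists_gamma1_mul_beta hp A hdet h00 h10 (not_dvd_of_dvd_level hp hpN A h00)
  have hmem : x
      * ((glCast (diagGL 1 p one_pos (Nat.cast_pos.mpr (NeZero.pos p))))
      * ((ModularGroup.T ^ (j : ℕ) : SL(2, ℤ)) : GL (Fin 2) ℝ))⁻¹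
      ∈ (Gamma1 N : Subgroup (GL (Fin 2) ℝ)) := mul_inv_mem_of_int hxA (coe_beta j) hγ hAγ
  exact ⟨⟨j, hj⟩, hmem, fun i hi ↦ beta_unique hi hmem⟩

/-- **Coset representatives, `p ∤ N`** (Diamond–Shurman (5.2)):
`Γ₁(N) diag(1,p) Γ₁(N) = ⊔_{0 ≤ j < p} Γ₁(N) β_j ⊔ Γ₁(N) σ diag(p,1)` for any `σ ∈ Γ₀(N)` with
lower-right entry `≡ p (mod N)`. The family is indexed by `Option (Fin p)` (`none ↦ β_∞`).
[cite: DiamondShurman2005, (5.2) and Prop. 5.2.1] -/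
theorem beta_reps_of_not_dvd (hp : p.Prime) [NeZero p] {σ : SL(2, ℤ)}
    (hσ : σ ∈ Gamma0 N) (hσp : ((σ 1 1 : ℤ) : ZMod N) = p) :
    (∀ o : Option (Fin p),
        (o.elim ((σ : GL (Fin 2) ℝ)
        * (glCast (diagGL p 1 (Nat.cast_pos.mpr (NeZero.pos p)) one_pos)))
        fun i ↦ (glCast (diagGL 1 p one_pos (Nat.cast_pos.mpr (NeZero.pos p))))
        * ((ModularGroup.T ^ (i : ℕ) : SL(2, ℤ)) : GL (Fin 2) ℝ)) ∈
        DoubleCoset.doubleCoset (glCast (diagGL 1 p one_pos (Nat.cast_pos.mpr (NeZero.pos p))))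
            ((Gamma1 N : Subgroup (GL (Fin 2) ℝ)) : Set (GL (Fin 2) ℝ))
            (Gamma1 N : Subgroup (GL (Fin 2) ℝ))) ∧
    ∀ x ∈ DoubleCoset.doubleCoset (glCast (diagGL 1 p one_pos (Nat.cast_pos.mpr (NeZero.pos p))))
        ((Gamma1 N : Subgroup (GL (Fin 2) ℝ)) : Set (GL (Fin 2) ℝ))
        (Gamma1 N : Subgroup (GL (Fin 2) ℝ)),
      ∃! o : Option (Fin p),
        x * (o.elim
            ((σ : GL (Fin 2) ℝ) * (glCast (diagGL p 1 (Nat.cast_pos.mpr (NeZero.pos p)) one_pos)))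
            fun i ↦ (glCast (diagGL 1 p one_pos (Nat.cast_pos.mpr (NeZero.pos p))))
            * ((ModularGroup.T ^ (i : ℕ) : SL(2, ℤ)) : GL (Fin 2) ℝ))⁻¹
            ∈ (Gamma1 N : Subgroup (GL (Fin 2) ℝ)) := by
  refine ⟨?_, fun x hx ↦ ?_⟩
  · rintro (_ | i)
    · exact beta_inf_mem_doubleCoset hp hσ hσp
    · exact beta_mem_doubleCoset i
  obtain ⟨A, hxA, hdet, h00, h10⟩ := exists_int_of_mem_doubleCoset hx
  by_cases h : (p : ℤ) ∣ A 0 0 ∧ (p : ℤ) ∣ A 1 0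
  · obtain ⟨γ, hγ, hAγ⟩ := exists_gamma1_mul_beta_inf hp A hdet h00 h10 h.1 h.2 hσ hσp
    have hnone : x
        * ((σ : GL (Fin 2) ℝ) * (glCast (diagGL p 1 (Nat.cast_pos.mpr (NeZero.pos p)) one_pos)))⁻¹
        ∈ (Gamma1 N : Subgroup (GL (Fin 2) ℝ)) := by
      refine mul_inv_mem_of_int hxA ?_ hγ hAγ
      rw [Matrix.GeneralLinearGroup.coe_mul, Matrix.map_mul_intCast, coe_SL_GL,
          coe_glCast_diagGL_one']
    refine ⟨none, hnone, ?_⟩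
    rintro (_ | i) hi
    · rfl
    · exact (beta_ne_beta_inf hp hi hnone).elim
  · obtain ⟨j, hj, γ, hγ, hAγ⟩ := exists_gamma1_mul_beta hp A hdet h00 h10 h
    have hsome : x
        * ((glCast (diagGL 1 p one_pos (Nat.cast_pos.mpr (NeZero.pos p))))
        * ((ModularGroup.T ^ (j : ℕ) : SL(2, ℤ)) : GL (Fin 2) ℝ))⁻¹
        ∈ (Gamma1 N : Subgroup (GL (Fin 2) ℝ)) := mul_inv_mem_of_int hxA (coe_beta j) hγ hAγ
    refine ⟨some ⟨j, hj⟩, hsome, ?_⟩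
    rintro (_ | i) hi
    · exact (beta_ne_beta_inf hp hsome hi).elim
    · exact congrArg some (beta_unique hi hsome)

/-! ### Conjugation by `Γ₀(N)` (Diamond–Shurman Prop. 5.2.4(a)) -/

/-- Conjugation by an element `τ` normalising `Γ` with `τ g τ⁻¹ ∈ Γ g Γ` preserves `Γ g Γ`.
[folklore] -/
theorem doubleCoset_conj_mem {G : Type*} [Group G] {Γ : Subgroup G} {g τ : G}
    (hτ : ∀ x ∈ Γ, τ * x * τ⁻¹ ∈ Γ)
    (hg : τ * g * τ⁻¹ ∈ DoubleCoset.doubleCoset g (Γ : Set G) Γ)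
    {y : G} (hy : y ∈ DoubleCoset.doubleCoset g (Γ : Set G) Γ) :
    τ * y * τ⁻¹ ∈ DoubleCoset.doubleCoset g (Γ : Set G) Γ := by
  obtain ⟨a, ha, b, hb, rfl⟩ := DoubleCoset.mem_doubleCoset.mp hy
  obtain ⟨a', ha', b', hb', hg⟩ := DoubleCoset.mem_doubleCoset.mp hg
  refine DoubleCoset.mem_doubleCoset.mpr ⟨τ * a * τ⁻¹ * a', Γ.mul_mem (hτ a ha) ha',
    b' * (τ * b * τ⁻¹), Γ.mul_mem hb' (hτ b hb), ?_⟩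
  calc τ * (a * g * b) * τ⁻¹ = (τ * a * τ⁻¹) * (τ * g * τ⁻¹) * (τ * b * τ⁻¹) := by group
    _ = _ := by rw [hg]; group

/-- **Conjugate representatives.** If `(αᵢ)` is a system of representatives of `Γ \ Γ g Γ` and `τ`
normalises `Γ` with `τ^{±1} g τ^{∓1} ∈ Γ g Γ`, then `(τ αᵢ τ⁻¹)` is again a system of
representatives
(Diamond–Shurman §5.2, the argument giving `⟨d⟩ T_p = T_p ⟨d⟩`). [cite: DiamondShurman2005, §5.2] -/
theorem reps_conj {G : Type*} [Group G] {Γ : Subgroup G} {g τ : G} {ι : Type*} {α : ι → G}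
    (hτ : ∀ x, x ∈ Γ ↔ τ * x * τ⁻¹ ∈ Γ)
    (hg : τ * g * τ⁻¹ ∈ DoubleCoset.doubleCoset g (Γ : Set G) Γ)
    (hg' : τ⁻¹ * g * τ ∈ DoubleCoset.doubleCoset g (Γ : Set G) Γ)
    (hα : ∀ i, α i ∈ DoubleCoset.doubleCoset g (Γ : Set G) Γ)
    (hα' : ∀ x ∈ DoubleCoset.doubleCoset g (Γ : Set G) Γ, ∃! i, x * (α i)⁻¹ ∈ Γ) :
    (∀ i, τ * α i * τ⁻¹ ∈ DoubleCoset.doubleCoset g (Γ : Set G) Γ) ∧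
    ∀ x ∈ DoubleCoset.doubleCoset g (Γ : Set G) Γ, ∃! i, x * (τ * α i * τ⁻¹)⁻¹ ∈ Γ := by
  have hτ' : ∀ x, x ∈ Γ ↔ τ⁻¹ * x * τ ∈ Γ := fun x ↦ by
    have h := hτ (τ⁻¹ * x * τ)
    rw [show τ * (τ⁻¹ * x * τ) * τ⁻¹ = x by group] at h
    exact h.symm
  refine ⟨fun i ↦ doubleCoset_conj_mem (fun x hx ↦ (hτ x).mp hx) hg (hα i), fun x hx ↦ ?_⟩
  have hx' : τ⁻¹ * x * τ⁻¹⁻¹ ∈ DoubleCoset.doubleCoset g (Γ : Set G) Γ :=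
    doubleCoset_conj_mem (τ := τ⁻¹) (fun x hx ↦ by simpa using (hτ' x).mp hx)
        (by simpa using hg') hx
  rw [inv_inv] at hx'
  obtain ⟨i, hi, huniq⟩ := hα' _ hx'
  have key : ∀ j, x * (τ * α j * τ⁻¹)⁻¹ ∈ Γ ↔ τ⁻¹ * x * τ * (α j)⁻¹ ∈ Γ := fun j ↦ by
    rw [hτ' (x * (τ * α j * τ⁻¹)⁻¹),
      show τ⁻¹ * (x * (τ * α j * τ⁻¹)⁻¹) * τ = τ⁻¹ * x * τ * (α j)⁻¹ by group]
  exact ⟨i, (key i).mpr hi, fun j hj ↦ huniq j ((key j).mp hj)⟩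

/-- `Γ₁(N)` is normalised by `Γ₀(N)` (it is the kernel of `Γ₀(N) → (ℤ/Nℤ)ˣ`; Diamond–Shurman §5.2,
p. 168). [folklore] -/
theorem Gamma1_conj_mem_of_mem_Gamma0 {τ γ : SL(2, ℤ)} (hτ : τ ∈ Gamma0 N) (hγ : γ ∈ Gamma1 N) :
    τ * γ * τ⁻¹ ∈ Gamma1 N := by
  have hn : (Gamma1' N).Normal := MonoidHom.normal_ker _
  obtain ⟨⟨⟨γ, hγ0⟩, hγ1⟩, -, rfl⟩ := hγ
  exact ⟨⟨_, hn.conj_mem _ hγ1 ⟨τ, hτ⟩⟩, Subgroup.mem_top _, rfl⟩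

/-- `x ∈ Γ₁(N) ↔ τ x τ⁻¹ ∈ Γ₁(N)` in `GL(2, ℝ)`, for `τ ∈ Γ₀(N)`. [folklore] -/
theorem mem_Gamma1_iff_conj_mem {τ : SL(2, ℤ)} (hτ : τ ∈ Gamma0 N) (x : GL (Fin 2) ℝ) :
    x ∈ (Gamma1 N : Subgroup (GL (Fin 2) ℝ)) ↔ (τ : GL (Fin 2) ℝ) * x * (τ : GL (Fin 2) ℝ)⁻¹
        ∈ (Gamma1 N : Subgroup (GL (Fin 2) ℝ)) := by
  constructor
  · rintro ⟨γ, hγ, rfl⟩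
    refine ⟨τ * γ * τ⁻¹, Gamma1_conj_mem_of_mem_Gamma0 hτ hγ, ?_⟩
    simp only [map_mul, map_inv]
    rfl
  · rintro ⟨γ, hγ, h⟩
    refine ⟨τ⁻¹ * γ * τ⁻¹⁻¹, Gamma1_conj_mem_of_mem_Gamma0 (inv_mem hτ) hγ, ?_⟩
    simp only [map_mul, map_inv, h, mapGL_eq_coe]
    group

/-- `τ diag(1,p) τ⁻¹ ∈ Γ₁(N) diag(1,p) Γ₁(N)` for `τ ∈ Γ₀(N)` (Diamond–Shurman §5.2).
[cite: DiamondShurman2005, §5.2] -/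
theorem gamma0_conj_D_mem (hp : p.Prime) [NeZero p] {τ : SL(2, ℤ)} (hτ : τ ∈ Gamma0 N) :
    (τ : GL (Fin 2) ℝ) * (glCast (diagGL 1 p one_pos (Nat.cast_pos.mpr (NeZero.pos p))))
        * (τ : GL (Fin 2) ℝ)⁻¹ ∈
      DoubleCoset.doubleCoset (glCast (diagGL 1 p one_pos (Nat.cast_pos.mpr (NeZero.pos p))))
          ((Gamma1 N : Subgroup (GL (Fin 2) ℝ)) : Set (GL (Fin 2) ℝ))
          (Gamma1 N : Subgroup (GL (Fin 2) ℝ)) := by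
  obtain ⟨hdet, h00, h10⟩ := gamma0_conj_diag hτ (p : ℤ)
  refine mem_doubleCoset_of_int hp ?_ hdet h00 h10
  have hinv : (τ : GL (Fin 2) ℝ)⁻¹ = ((τ⁻¹ : SL(2, ℤ)) : GL (Fin 2) ℝ) := by simp [map_inv]
  rw [hinv, Matrix.GeneralLinearGroup.coe_mul, Matrix.GeneralLinearGroup.coe_mul,
    Matrix.map_mul_intCast, Matrix.map_mul_intCast, coe_SL_GL, coe_SL_GL, coe_glCast_diagGL_one]

/-- There is a (finite) system of representatives of `Γ₁(N) \ Γ₁(N) diag(1,p) Γ₁(N)`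
(Diamond–Shurman (5.2)). [cite: DiamondShurman2005, (5.2)] -/
theorem exists_reps (hp : p.Prime) [NeZero p] (N : ℕ) :
    ∃ (ι : Type) (_ : Fintype ι) (α : ι → GL (Fin 2) ℝ),
      (∀ i, α i ∈ DoubleCoset.doubleCoset
          (glCast (diagGL 1 p one_pos (Nat.cast_pos.mpr (NeZero.pos p))))
          ((Gamma1 N : Subgroup (GL (Fin 2) ℝ)) : Set (GL (Fin 2) ℝ))
          (Gamma1 N : Subgroup (GL (Fin 2) ℝ))) ∧
      ∀ x ∈ DoubleCoset.doubleCoset (glCast (diagGL 1 p one_pos (Nat.cast_pos.mpr (NeZero.pos p))))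
          ((Gamma1 N : Subgroup (GL (Fin 2) ℝ)) : Set (GL (Fin 2) ℝ))
          (Gamma1 N : Subgroup (GL (Fin 2) ℝ)),
        ∃! i, x * (α i)⁻¹ ∈ (Gamma1 N : Subgroup (GL (Fin 2) ℝ)) := by
  by_cases hpN : p ∣ N
  · exact ⟨Fin p, inferInstance, _, beta_reps_of_dvd hp hpN⟩
  · obtain ⟨σ, hσ, hσp, -⟩ := exists_gamma0_entry_eq hp hpN
    exact ⟨Option (Fin p), inferInstance, _, beta_reps_of_not_dvd hp hσ hσp⟩

/-! ### The operator `T_p` on `S_k(Γ₁(N))` via representatives -/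

variable [NeZero N]

/-- `T_p f = ∑ᵢ f ∣[k] αᵢ` for any system of representatives `(αᵢ)` of
`Γ₁(N) \ Γ₁(N) diag(1,p) Γ₁(N)` (Diamond–Shurman (5.1) and Prop. 5.2.1).
[cite: DiamondShurman2005, (5.1)] -/
theorem heckeT_eq_sum_of_reps [NeZero p] {ι : Type} [Fintype ι] {α : ι → GL (Fin 2) ℝ}
    (hα : ∀ i, α i
        ∈ DoubleCoset.doubleCoset (glCast (diagGL 1 p one_pos (Nat.cast_pos.mpr (NeZero.pos p))))
        ((Gamma1 N : Subgroup (GL (Fin 2) ℝ)) : Set (GL (Fin 2) ℝ))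
        (Gamma1 N : Subgroup (GL (Fin 2) ℝ)))
    (hα' : ∀ x ∈ DoubleCoset.doubleCoset
        (glCast (diagGL 1 p one_pos (Nat.cast_pos.mpr (NeZero.pos p))))
        ((Gamma1 N : Subgroup (GL (Fin 2) ℝ)) : Set (GL (Fin 2) ℝ))
        (Gamma1 N : Subgroup (GL (Fin 2) ℝ)),
      ∃! i, x * (α i)⁻¹ ∈ (Gamma1 N : Subgroup (GL (Fin 2) ℝ))) (k : ℤ)
          (f : CuspForm (Gamma1 N) k) :
    ⇑(heckeT (Gamma1 N) k p f) = ∑ i, ⇑f ∣[k] α i :=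
  heckeOperator_apply_eq_sum_slash_holds (Gamma1 N) k _ α hα hα' f

/-- **`T_p` via the representatives (5.2)** (Diamond–Shurman Prop. 5.2.1 / eq. (5.2)): for
`f ∈ S_k(Γ₁(N))` and `p` prime,
`T_p f = ∑_{0 ≤ j < p} f ∣[k] (1 j; 0 p) + [p ∤ N] · f ∣[k] (σ diag(p, 1))`,
where `σ ∈ Γ₀(N)` is any matrix with lower-right entry `≡ p (mod N)` (irrelevant if `p ∣ N`).
Here `f ∣[k] g` is Mathlib's slash action, i.e. Diamond–Shurman's `f[g]_k`.
[cite: DiamondShurman2005, Prop. 5.2.1 and (5.2)] -/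
theorem heckeT_gamma1_apply (hp : p.Prime) [NeZero p] (σ : SL(2, ℤ))
    (hσ : ¬ p ∣ N → σ ∈ Gamma0 N ∧ ((σ 1 1 : ℤ) : ZMod N) = p) (k : ℤ) (f : CuspForm (Gamma1 N) k) :
    ⇑(heckeT (Gamma1 N) k p f)
        = (∑ i : Fin p, ⇑f ∣[k]
        ((glCast (diagGL 1 p one_pos (Nat.cast_pos.mpr (NeZero.pos p))))
        * ((ModularGroup.T ^ (i : ℕ) : SL(2, ℤ)) : GL (Fin 2) ℝ))) +
      if p ∣ N then 0 else ⇑f ∣[k]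
          ((σ : GL (Fin 2) ℝ)
          * (glCast (diagGL p 1 (Nat.cast_pos.mpr (NeZero.pos p)) one_pos))) := by
  by_cases hpN : p ∣ N
  · rw [if_pos hpN, add_zero]
    obtain ⟨hα, hα'⟩ := beta_reps_of_dvd (N := N) hp hpN
    exact heckeT_eq_sum_of_reps hα hα' k f
  · rw [if_neg hpN]
    obtain ⟨hσ0, hσp⟩ := hσ hpN
    obtain ⟨hα, hα'⟩ := beta_reps_of_not_dvd hp hσ0 hσp
    rw [heckeT_eq_sum_of_reps hα hα' k f, Fintype.sum_option, add_comm]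
    rfl

/-- **`T_p` commutes with the action of `Γ₀(N)`** (Diamond–Shurman Prop. 5.2.4(a),
`⟨d⟩ T_p = T_p ⟨d⟩`, at the level of functions): if `f' = f ∣[k] τ` with `τ ∈ Γ₀(N)` then
`T_p f' = (T_p f) ∣[k] τ`. [cite: DiamondShurman2005, Prop. 5.2.4(a)] -/
theorem heckeT_slash_gamma0 (hp : p.Prime) [NeZero p] {τ : SL(2, ℤ)} (hτ : τ ∈ Gamma0 N)
    (k : ℤ) (f f' : CuspForm (Gamma1 N) k) (hf' : ⇑f' = ⇑f ∣[k] (τ : GL (Fin 2) ℝ)) :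
    ⇑(heckeT (Gamma1 N) k p f') = ⇑(heckeT (Gamma1 N) k p f) ∣[k] (τ : GL (Fin 2) ℝ) := by
  obtain ⟨ι, _, α, hα, hα'⟩ := exists_reps hp N
  have hτ' : ∀ x, x ∈ (Gamma1 N : Subgroup (GL (Fin 2) ℝ)) ↔
      (τ : GL (Fin 2) ℝ)⁻¹ * x * (τ : GL (Fin 2) ℝ)⁻¹⁻¹
          ∈ (Gamma1 N : Subgroup (GL (Fin 2) ℝ)) := fun x ↦ by
    simpa using mem_Gamma1_iff_conj_mem (inv_mem hτ) x
  obtain ⟨hβ, hβ'⟩ := reps_conj (τ := (τ : GL (Fin 2) ℝ)⁻¹) hτ'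
    (by simpa using gamma0_conj_D_mem hp (inv_mem hτ)) (by simpa using gamma0_conj_D_mem hp hτ)
    hα hα'
  rw [heckeT_eq_sum_of_reps hβ hβ' k f', heckeT_eq_sum_of_reps hα hα' k f, SlashAction.sum_slash]
  refine Finset.sum_congr rfl fun i _ ↦ ?_
  rw [hf', ← SlashAction.slash_mul, ← SlashAction.slash_mul]
  congr 1
  group

/-- For `τ ∈ Γ₀(N)`, `f ∣[k] τ` is again a cusp form of level `Γ₁(N)` (it is `[Γ₁(N) τ Γ₁(N)] f`,
the double coset being the single coset `Γ₁(N) τ`; Diamond–Shurman §5.2, diamond operators).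
[cite: DiamondShurman2005, §5.2] -/
theorem exists_cuspForm_slash {τ : SL(2, ℤ)} (hτ : τ ∈ Gamma0 N) (k : ℤ)
    (f : CuspForm (Gamma1 N) k) :
    ∃ f' : CuspForm (Gamma1 N) k, ⇑f' = ⇑f ∣[k] (τ : GL (Fin 2) ℝ) := by
  refine ⟨cuspHeckeOperator (Gamma1 N) k (Matrix.SpecialLinearGroup.mapGL ℚ τ) f, ?_⟩
  have hcast : glCast (Matrix.SpecialLinearGroup.mapGL ℚ τ) = (τ : GL (Fin 2) ℝ) := by
    ext i j; simp [glCast]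
  change ⇑(heckeOperator (Gamma1 N) k (Matrix.SpecialLinearGroup.mapGL ℚ τ)
    (f : ModularForm (Gamma1 N) k)) = _
  rw [heckeOperator_apply_eq_sum_slash_holds (Gamma1 N) k _ (fun _ : Unit ↦ (τ : GL (Fin 2) ℝ))
    ?_ ?_ f]
  · simp
  · intro
    rw [hcast]
    exact DoubleCoset.mem_doubleCoset_self _ _ _
  · intro x hx
    rw [hcast] at hx
    refine ⟨(), ?_, fun _ _ ↦ rfl⟩
    obtain ⟨a, ha, b, hb, rfl⟩ := DoubleCoset.mem_doubleCoset.mp hx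
    have := (mem_Gamma1_iff_conj_mem hτ b).mp hb
    simpa [mul_assoc] using mul_mem ha this

/-! ### Commutativity `T_p T_q = T_q T_p` (Diamond–Shurman Prop. 5.2.4(c)) -/

omit [NeZero N] in
/-- The image in `GL(2, ℝ)` of an element of `Γ₁(N)` lies in the image of `Γ₁(N)`. [folklore] -/
theorem coe_mem_Gamma1 {γ : SL(2, ℤ)} (hγ : γ ∈ Gamma1 N) : (γ : GL (Fin 2) ℝ)
    ∈ (Gamma1 N : Subgroup (GL (Fin 2) ℝ)) :=
  Subgroup.mem_map_of_mem _ hγ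

omit [NeZero N] in
/-- `diag(1,a) diag(1,b) = diag(1,b) diag(1,a)`. [folklore] -/
theorem D_comm (a b : ℕ) [NeZero a] [NeZero b]
    : ((glCast (diagGL 1 a one_pos (Nat.cast_pos.mpr (NeZero.pos a))))
    * (glCast (diagGL 1 b one_pos (Nat.cast_pos.mpr (NeZero.pos b)))) : GL (Fin 2) ℝ)
    = (glCast (diagGL 1 b one_pos (Nat.cast_pos.mpr (NeZero.pos b))))
    * (glCast (diagGL 1 a one_pos (Nat.cast_pos.mpr (NeZero.pos a)))) := by
  refine GL_eq_of_map_eq (A := !![(1 : ℤ), 0; 0, a] * !![(1 : ℤ), 0; 0, b])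
    (B := !![(1 : ℤ), 0; 0, b] * !![(1 : ℤ), 0; 0, a]) ?_ ?_ ?_
  · rw [Matrix.GeneralLinearGroup.coe_mul, Matrix.map_mul_intCast, coe_glCast_diagGL_one,
      coe_glCast_diagGL_one]
  · rw [Matrix.GeneralLinearGroup.coe_mul, Matrix.map_mul_intCast, coe_glCast_diagGL_one,
      coe_glCast_diagGL_one]
  · simp [mul_comm]

omit [NeZero N] in
/-- `diag(a,1) diag(b,1) = diag(b,1) diag(a,1)`. [folklore] -/
theorem D'_comm (a b : ℕ) [NeZero a] [NeZero b] :
    ((glCast (diagGL a 1 (Nat.cast_pos.mpr (NeZero.pos a)) one_pos))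
        * (glCast (diagGL b 1 (Nat.cast_pos.mpr (NeZero.pos b)) one_pos)) : GL (Fin 2) ℝ)
        = (glCast (diagGL b 1 (Nat.cast_pos.mpr (NeZero.pos b)) one_pos))
        * (glCast (diagGL a 1 (Nat.cast_pos.mpr (NeZero.pos a)) one_pos)) := by
  refine GL_eq_of_map_eq (A := !![(a : ℤ), 0; 0, 1] * !![(b : ℤ), 0; 0, 1])
    (B := !![(b : ℤ), 0; 0, 1] * !![(a : ℤ), 0; 0, 1]) ?_ ?_ ?_
  · rw [Matrix.GeneralLinearGroup.coe_mul, Matrix.map_mul_intCast, coe_glCast_diagGL_one',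
      coe_glCast_diagGL_one']
  · rw [Matrix.GeneralLinearGroup.coe_mul, Matrix.map_mul_intCast, coe_glCast_diagGL_one',
      coe_glCast_diagGL_one']
  · simp [mul_comm]

omit [NeZero N] in
/-- `β^{(a)}_i β^{(b)}_j = diag(1,b) diag(1,a) T^{j + b i}`, i.e.
`(1 i; 0 a)(1 j; 0 b) = (1, j + b i; 0, ab)`. [folklore] -/
theorem beta_mul_beta (a b : ℕ) [NeZero a] [NeZero b] (i j : ℕ) :
    ((glCast (diagGL 1 a one_pos (Nat.cast_pos.mpr (NeZero.pos a))))
        * ((ModularGroup.T ^ (i : ℕ) : SL(2, ℤ)) : GL (Fin 2) ℝ)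
        * ((glCast (diagGL 1 b one_pos (Nat.cast_pos.mpr (NeZero.pos b))))
        * ((ModularGroup.T ^ (j : ℕ) : SL(2, ℤ)) : GL (Fin 2) ℝ)) : GL (Fin 2) ℝ)
        = (glCast (diagGL 1 b one_pos (Nat.cast_pos.mpr (NeZero.pos b))))
        * (glCast (diagGL 1 a one_pos (Nat.cast_pos.mpr (NeZero.pos a))))
        * ((ModularGroup.T ^ (j + b * i : ℕ) : SL(2, ℤ)) : GL (Fin 2) ℝ) := by
  refine GL_eq_of_map_eq (A := !![(1 : ℤ), i; 0, a] * !![(1 : ℤ), j; 0, b])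
    (B := !![(1 : ℤ), 0; 0, b] * !![(1 : ℤ), 0; 0, a] * !![1, ((j + b * i : ℕ) : ℤ); 0, 1]) ?_ ?_ ?_
  · rw [Matrix.GeneralLinearGroup.coe_mul, Matrix.map_mul_intCast, coe_beta, coe_beta]
  · rw [Matrix.GeneralLinearGroup.coe_mul, Matrix.GeneralLinearGroup.coe_mul,
      Matrix.map_mul_intCast,
      Matrix.map_mul_intCast, coe_glCast_diagGL_one, coe_glCast_diagGL_one, coe_SL_GL, coe_T_pow]
  · ext x y
    fin_cases x <;> fin_cases y <;> simp [Matrix.mul_apply, Fin.sum_univ_two] <;> ring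

omit [NeZero N] in
/-- `diag(q,1) β^{(p)}_i = T^t β^{(p)}_r diag(q,1)` where `q i = t p + r`, `0 ≤ r < p`, i.e.
`(q, qi; 0, p) = (1 t; 0 1)(q, r; 0, p)`. [folklore] -/
theorem D'_mul_beta (p q : ℕ) [NeZero p] [NeZero q] {i t r : ℕ} (h : p * t + r = q * i) :
    ((glCast (diagGL q 1 (Nat.cast_pos.mpr (NeZero.pos q)) one_pos))
        * ((glCast (diagGL 1 p one_pos (Nat.cast_pos.mpr (NeZero.pos p))))
        * ((ModularGroup.T ^ (i : ℕ) : SL(2, ℤ)) : GL (Fin 2) ℝ)) : GL (Fin 2) ℝ)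
        = ((ModularGroup.T ^ (t : ℕ) : SL(2, ℤ)) : GL (Fin 2) ℝ)
        * ((glCast (diagGL 1 p one_pos (Nat.cast_pos.mpr (NeZero.pos p))))
        * ((ModularGroup.T ^ (r : ℕ) : SL(2, ℤ)) : GL (Fin 2) ℝ)
        * (glCast (diagGL q 1 (Nat.cast_pos.mpr (NeZero.pos q)) one_pos))) := by
  refine GL_eq_of_map_eq (A := !![(q : ℤ), 0; 0, 1] * !![(1 : ℤ), i; 0, p])
    (B := !![1, (t : ℤ); 0, 1] * (!![(1 : ℤ), r; 0, p] * !![(q : ℤ), 0; 0, 1])) ?_ ?_ ?_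
  · rw [Matrix.GeneralLinearGroup.coe_mul, Matrix.map_mul_intCast, coe_glCast_diagGL_one', coe_beta]
  · rw [Matrix.GeneralLinearGroup.coe_mul, Matrix.GeneralLinearGroup.coe_mul,
      Matrix.map_mul_intCast,
      Matrix.map_mul_intCast, coe_glCast_diagGL_one', coe_beta, coe_SL_GL, coe_T_pow]
  · zify at h
    ext x y
    fin_cases x <;> fin_cases y <;> simp [Matrix.mul_apply, Fin.sum_univ_two]
    linear_combination -h

omit [NeZero N] in
/-- Reindexing sums over `Fin m × Fin n` along `(a, b) ↦ b + n a`. [folklore] -/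
theorem sum_sum_eq_sum_range {M : Type*} [AddCommMonoid M] (m n : ℕ) (G : ℕ → M) :
    ∑ a : Fin m, ∑ b : Fin n, G (b + n * a) = ∑ t ∈ Finset.range (m * n), G t := by
  rw [← Fin.sum_univ_eq_sum_range, ← Equiv.sum_comp finProdFinEquiv, Fintype.sum_prod_type]
  rfl

omit [NeZero N] in
/-- The "upper-triangular parts" `U_p F = ∑_{0 ≤ i < p} F ∣[k] (1 i; 0 p)` of `T_p` and `T_q`
commute on arbitrary functions: both `U_p U_q F` and `U_q U_p F` equal
`∑_{0 ≤ t < pq} F ∣[k] (1 t; 0 pq)` (cf. Diamond–Shurman, proof of Prop. 5.2.4(c)).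
[folklore] -/
theorem sum_slash_beta_comm (p q : ℕ) [NeZero p] [NeZero q] (k : ℤ) (F : ℍ → ℂ) :
    ∑ i : Fin p,
        (∑ j : Fin q, F ∣[k]
        ((glCast (diagGL 1 q one_pos (Nat.cast_pos.mpr (NeZero.pos q))))
        * ((ModularGroup.T ^ (j : ℕ) : SL(2, ℤ)) : GL (Fin 2) ℝ))) ∣[k]
        ((glCast (diagGL 1 p one_pos (Nat.cast_pos.mpr (NeZero.pos p))))
        * ((ModularGroup.T ^ (i : ℕ) : SL(2, ℤ)) : GL (Fin 2) ℝ)) =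
      ∑ j : Fin q,
          (∑ i : Fin p, F ∣[k]
          ((glCast (diagGL 1 p one_pos (Nat.cast_pos.mpr (NeZero.pos p))))
          * ((ModularGroup.T ^ (i : ℕ) : SL(2, ℤ)) : GL (Fin 2) ℝ))) ∣[k]
          ((glCast (diagGL 1 q one_pos (Nat.cast_pos.mpr (NeZero.pos q))))
          * ((ModularGroup.T ^ (j : ℕ) : SL(2, ℤ)) : GL (Fin 2) ℝ)) := by
  have h1 : ∀ (i : Fin p) (j : Fin q),
      (F ∣[k] ((glCast (diagGL 1 q one_pos (Nat.cast_pos.mpr (NeZero.pos q))))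
          * ((ModularGroup.T ^ (j : ℕ) : SL(2, ℤ)) : GL (Fin 2) ℝ))) ∣[k]
          ((glCast (diagGL 1 p one_pos (Nat.cast_pos.mpr (NeZero.pos p))))
          * ((ModularGroup.T ^ (i : ℕ) : SL(2, ℤ)) : GL (Fin 2) ℝ)) =
        F ∣[k] ((glCast (diagGL 1 p one_pos (Nat.cast_pos.mpr (NeZero.pos p))))
            * (glCast (diagGL 1 q one_pos (Nat.cast_pos.mpr (NeZero.pos q))))
            * ((ModularGroup.T ^ ((i : ℕ) + p * (j : ℕ)) : SL(2, ℤ))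
            : GL (Fin 2) ℝ)) := fun i j ↦ by
    rw [← SlashAction.slash_mul, beta_mul_beta]
  have h2 : ∀ (j : Fin q) (i : Fin p),
      (F ∣[k] ((glCast (diagGL 1 p one_pos (Nat.cast_pos.mpr (NeZero.pos p))))
          * ((ModularGroup.T ^ (i : ℕ) : SL(2, ℤ)) : GL (Fin 2) ℝ))) ∣[k]
          ((glCast (diagGL 1 q one_pos (Nat.cast_pos.mpr (NeZero.pos q))))
          * ((ModularGroup.T ^ (j : ℕ) : SL(2, ℤ)) : GL (Fin 2) ℝ)) =
        F ∣[k] ((glCast (diagGL 1 p one_pos (Nat.cast_pos.mpr (NeZero.pos p))))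
            * (glCast (diagGL 1 q one_pos (Nat.cast_pos.mpr (NeZero.pos q))))
            * ((ModularGroup.T ^ ((j : ℕ) + q * (i : ℕ)) : SL(2, ℤ))
            : GL (Fin 2) ℝ)) := fun j i ↦ by
    rw [← SlashAction.slash_mul, beta_mul_beta, D_comm q p]
  simp only [SlashAction.sum_slash, h1, h2]
  rw [Finset.sum_comm,
      sum_sum_eq_sum_range q p
      (fun t ↦ F ∣[k]
      ((glCast (diagGL 1 p one_pos (Nat.cast_pos.mpr (NeZero.pos p))))
      * (glCast (diagGL 1 q one_pos (Nat.cast_pos.mpr (NeZero.pos q))))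
      * ((ModularGroup.T ^ (t : ℕ) : SL(2, ℤ)) : GL (Fin 2) ℝ))),
    Finset.sum_comm,
        sum_sum_eq_sum_range p q
        (fun t ↦ F ∣[k]
        ((glCast (diagGL 1 p one_pos (Nat.cast_pos.mpr (NeZero.pos p))))
        * (glCast (diagGL 1 q one_pos (Nat.cast_pos.mpr (NeZero.pos q))))
        * ((ModularGroup.T ^ (t : ℕ) : SL(2, ℤ)) : GL (Fin 2) ℝ))), mul_comm]

omit [NeZero N] in
/-- For `f` of level `Γ₁(N)` and distinct primes `p, q`:
`∑_{i<p} f ∣[k] diag(q,1) ∣[k] β^{(p)}_i = ∑_{i<p} f ∣[k] β^{(p)}_i ∣[k] diag(q,1)`, by the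
reindexing `i ↦ q i mod p` and `T`-invariance of `f` (Diamond–Shurman, proof of Prop. 5.2.4(c)).
[folklore] -/
theorem sum_slash_D'_beta_comm (hp : p.Prime) {q : ℕ} (hq : q.Prime) (hpq : p ≠ q) [NeZero p]
    [NeZero q] (k : ℤ) (g : CuspForm (Gamma1 N) k) :
    ∑ i : Fin p, (⇑g ∣[k] (glCast (diagGL q 1 (Nat.cast_pos.mpr (NeZero.pos q)) one_pos))) ∣[k]
        ((glCast (diagGL 1 p one_pos (Nat.cast_pos.mpr (NeZero.pos p))))
        * ((ModularGroup.T ^ (i : ℕ) : SL(2, ℤ)) : GL (Fin 2) ℝ)) =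
      ∑ i : Fin p,
          (⇑g ∣[k] ((glCast (diagGL 1 p one_pos (Nat.cast_pos.mpr (NeZero.pos p))))
          * ((ModularGroup.T ^ (i : ℕ) : SL(2, ℤ)) : GL (Fin 2) ℝ))) ∣[k]
          (glCast (diagGL q 1 (Nat.cast_pos.mpr (NeZero.pos q)) one_pos)) := by
  -- the reindexing bijection `i ↦ q i mod p`
  let r : Fin p → Fin p := fun i ↦ ⟨q * i % p, Nat.mod_lt _ hp.pos⟩
  have hr : Function.Bijective r := by
    rw [← Finite.injective_iff_bijective]
    intro i j hij
    have hij : q * i % p = q * j % p := by simpa [r] using congrArg Fin.val hij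
    have hcop : Nat.Coprime p q := (Nat.coprime_primes hp hq).mpr hpq
    exact Fin.ext (Nat.ModEq.eq_of_lt_of_lt (Nat.ModEq.cancel_left_of_coprime hcop hij) i.2 j.2)
  have key : ∀ i : Fin p, (⇑g ∣[k] (glCast (diagGL q 1 (Nat.cast_pos.mpr (NeZero.pos q)) one_pos)))
      ∣[k] ((glCast (diagGL 1 p one_pos (Nat.cast_pos.mpr (NeZero.pos p))))
      * ((ModularGroup.T ^ (i : ℕ) : SL(2, ℤ)) : GL (Fin 2) ℝ)) =
      (⇑g ∣[k] ((glCast (diagGL 1 p one_pos (Nat.cast_pos.mpr (NeZero.pos p))))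
          * ((ModularGroup.T ^ (r i : ℕ) : SL(2, ℤ)) : GL (Fin 2) ℝ))) ∣[k]
          (glCast (diagGL q 1 (Nat.cast_pos.mpr (NeZero.pos q)) one_pos)) := fun i ↦ by
    rw [← SlashAction.slash_mul, ← SlashAction.slash_mul,
      D'_mul_beta p q (Nat.div_add_mod (q * (i : ℕ)) p), SlashAction.slash_mul,
      SlashInvariantFormClass.slash_action_eq g _ (coe_mem_Gamma1 (T_pow_mem_Gamma1 _))]
  simp only [key]
  exact hr.sum_comp
      (fun j : Fin p ↦
      (⇑g ∣[k] ((glCast (diagGL 1 p one_pos (Nat.cast_pos.mpr (NeZero.pos p))))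
      * ((ModularGroup.T ^ (j : ℕ) : SL(2, ℤ)) : GL (Fin 2) ℝ))) ∣[k]
      (glCast (diagGL q 1 (Nat.cast_pos.mpr (NeZero.pos q)) one_pos)))

omit [NeZero N] in
/-- The commutator of two elements of `Γ₀(N)` lies in `Γ₁(N)` (`Γ₀(N)/Γ₁(N) ≅ (ℤ/Nℤ)ˣ` is
abelian; Diamond–Shurman §5.2, hence `⟨d⟩⟨e⟩ = ⟨e⟩⟨d⟩`, Prop. 5.2.4(b)).
[cite: DiamondShurman2005, Prop. 5.2.4(b)] -/
theorem commutator_mem_Gamma1 {a b : SL(2, ℤ)} (ha : a ∈ Gamma0 N) (hb : b ∈ Gamma0 N) :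
    a * b * a⁻¹ * b⁻¹ ∈ Gamma1 N := by
  have h : (⟨a, ha⟩ * ⟨b, hb⟩ * ⟨a, ha⟩⁻¹ * ⟨b, hb⟩⁻¹ : Gamma0 N) ∈ Gamma1' N := by
    rw [Gamma1_mem', map_mul, map_mul, map_mul, mul_right_comm (Gamma0Map N ⟨a, ha⟩), ← map_mul,
      mul_inv_cancel, map_one, one_mul, ← map_mul, mul_inv_cancel, map_one]
  exact ⟨⟨_, h⟩, Subgroup.mem_top _, rfl⟩

omit [NeZero N] in
/-- The `β_∞ β_∞` terms of `T_p T_q` and `T_q T_p` agree: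
`f ∣ σ_p σ_q diag(q,1) diag(p,1) = f ∣ σ_q σ_p diag(p,1) diag(q,1)` for `f` of level `Γ₁(N)`.
[folklore] -/
theorem slash_sigma_sigma_comm {q : ℕ} [NeZero p] [NeZero q] {σp σq : SL(2, ℤ)}
    (hσp : σp ∈ Gamma0 N) (hσq : σq ∈ Gamma0 N) (k : ℤ) (f : CuspForm (Gamma1 N) k) :
    ⇑f ∣[k] ((σp : GL (Fin 2) ℝ)
        * ((σq : GL (Fin 2) ℝ) * (glCast (diagGL q 1 (Nat.cast_pos.mpr (NeZero.pos q)) one_pos)))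
        * (glCast (diagGL p 1 (Nat.cast_pos.mpr (NeZero.pos p)) one_pos))) =
      ⇑f ∣[k] ((σq : GL (Fin 2) ℝ)
          * ((σp : GL (Fin 2) ℝ) * (glCast (diagGL p 1 (Nat.cast_pos.mpr (NeZero.pos p)) one_pos)))
          * (glCast (diagGL q 1 (Nat.cast_pos.mpr (NeZero.pos q)) one_pos))) := by
  have hγ := commutator_mem_Gamma1 hσp hσq
  have : ((σp : GL (Fin 2) ℝ)
      * ((σq : GL (Fin 2) ℝ) * (glCast (diagGL q 1 (Nat.cast_pos.mpr (NeZero.pos q)) one_pos)))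
      * (glCast (diagGL p 1 (Nat.cast_pos.mpr (NeZero.pos p)) one_pos))) =
      ((σp * σq * σp⁻¹ * σq⁻¹ : SL(2, ℤ)) : GL (Fin 2) ℝ) *
        ((σq : GL (Fin 2) ℝ)
            * ((σp : GL (Fin 2) ℝ)
            * (glCast (diagGL p 1 (Nat.cast_pos.mpr (NeZero.pos p)) one_pos)))
            * (glCast (diagGL q 1 (Nat.cast_pos.mpr (NeZero.pos q)) one_pos))) := by
    simp only [map_mul, map_inv, mul_assoc, inv_mul_cancel_left]
    rw [D'_comm q p]
  rw [this, SlashAction.slash_mul, SlashInvariantFormClass.slash_action_eq f _ (coe_mem_Gamma1 hγ)]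

/-- `(if c then 0 else F) ∣[k] g = if c then 0 else F ∣[k] g`. [folklore] -/
theorem ite_zero_slash (c : Prop) [Decidable c] (k : ℤ) (F : ℍ → ℂ) (g : GL (Fin 2) ℝ) :
    (if c then (0 : ℍ → ℂ) else F) ∣[k] g = if c then 0 else F ∣[k] g := by
  split_ifs <;> simp

/-- **Commutativity of the Hecke operators `T_p`** on `S_k(Γ₁(N))` for primes `p, q`
(Diamond–Shurman Prop. 5.2.4(c)). Proof: expand both sides with `heckeT_gamma1_apply`, using
`heckeT_slash_gamma0` for the `β_∞` terms; the four groups of terms match by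
`sum_slash_beta_comm`, `sum_slash_D'_beta_comm` and `slash_sigma_sigma_comm`.
[cite: DiamondShurman2005, Prop. 5.2.4(c)] -/
theorem heckeT_comm_of_prime (hp : p.Prime) {q : ℕ} (hq : q.Prime) [NeZero p] [NeZero q] (k : ℤ) :
    heckeT (Gamma1 N) k p * heckeT (Gamma1 N) k q = heckeT (Gamma1 N) k q
        * heckeT (Gamma1 N) k p := by
  rcases eq_or_ne p q with rfl | hpq
  · rfl
  -- auxiliary matrices `σ_p, σ_q ∈ Γ₀(N)`
  have hσ : ∀ {r : ℕ}, r.Prime → ∃ σ : SL(2, ℤ), σ ∈ Gamma0 N ∧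
      (¬ r ∣ N → σ ∈ Gamma0 N ∧ ((σ 1 1 : ℤ) : ZMod N) = r) := by
    intro r hr
    by_cases h : r ∣ N
    · exact ⟨1, Subgroup.one_mem _, fun h' ↦ (h' h).elim⟩
    · obtain ⟨σ, hσ, hσr, -⟩ := exists_gamma0_entry_eq hr h
      exact ⟨σ, hσ, fun _ ↦ ⟨hσ, hσr⟩⟩
  obtain ⟨σp, hσp0, hσp⟩ := hσ hp
  obtain ⟨σq, hσq0, hσq⟩ := hσ hq
  apply LinearMap.ext
  intro f
  rw [Module.End.mul_apply, Module.End.mul_apply]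
  apply DFunLike.coe_injective
  obtain ⟨fp, hfp⟩ := exists_cuspForm_slash hσp0 k f
  obtain ⟨fq, hfq⟩ := exists_cuspForm_slash hσq0 k f
  have Ap : ⇑(heckeT (Gamma1 N) k q f) ∣[k]
      ((σp : GL (Fin 2) ℝ) * (glCast (diagGL p 1 (Nat.cast_pos.mpr (NeZero.pos p)) one_pos))) =
      ⇑(heckeT (Gamma1 N) k q fp) ∣[k]
          (glCast (diagGL p 1 (Nat.cast_pos.mpr (NeZero.pos p)) one_pos)) := by
    rw [SlashAction.slash_mul, heckeT_slash_gamma0 hq hσp0 k f fp hfp]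
  have Aq : ⇑(heckeT (Gamma1 N) k p f) ∣[k]
      ((σq : GL (Fin 2) ℝ) * (glCast (diagGL q 1 (Nat.cast_pos.mpr (NeZero.pos q)) one_pos))) =
      ⇑(heckeT (Gamma1 N) k p fq) ∣[k]
          (glCast (diagGL q 1 (Nat.cast_pos.mpr (NeZero.pos q)) one_pos)) := by
    rw [SlashAction.slash_mul, heckeT_slash_gamma0 hp hσq0 k f fq hfq]
  change ⇑(heckeT (Gamma1 N) k p (heckeT (Gamma1 N) k q f))
      = ⇑(heckeT (Gamma1 N) k q (heckeT (Gamma1 N) k p f))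
  rw [heckeT_gamma1_apply hp σp hσp k, Ap, heckeT_gamma1_apply hq σq hσq k f,
    heckeT_gamma1_apply hq σq hσq k fp]
  rw [heckeT_gamma1_apply hq σq hσq k, Aq, heckeT_gamma1_apply hp σp hσp k f,
    heckeT_gamma1_apply hp σp hσp k fq]
  simp only [SlashAction.add_slash, SlashAction.sum_slash, ite_zero_slash, Finset.sum_add_distrib,
    Finset.sum_ite_irrel, Finset.sum_const_zero]
  -- the four groups of terms
  have K2 := sum_slash_beta_comm p q k ⇑f
  simp only [SlashAction.sum_slash] at K2
  have B1 : ⇑f ∣[k]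
      ((σq : GL (Fin 2) ℝ) * (glCast (diagGL q 1 (Nat.cast_pos.mpr (NeZero.pos q)) one_pos))) = ⇑fq
      ∣[k] (glCast (diagGL q 1 (Nat.cast_pos.mpr (NeZero.pos q)) one_pos)) := by
    rw [SlashAction.slash_mul, hfq]
  have B2 : ⇑f ∣[k]
      ((σp : GL (Fin 2) ℝ) * (glCast (diagGL p 1 (Nat.cast_pos.mpr (NeZero.pos p)) one_pos))) = ⇑fp
      ∣[k] (glCast (diagGL p 1 (Nat.cast_pos.mpr (NeZero.pos p)) one_pos)) := by
    rw [SlashAction.slash_mul, hfp]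
  have C1 : (⇑fp ∣[k]
      ((σq : GL (Fin 2) ℝ) * (glCast (diagGL q 1 (Nat.cast_pos.mpr (NeZero.pos q)) one_pos)))) ∣[k]
      (glCast (diagGL p 1 (Nat.cast_pos.mpr (NeZero.pos p)) one_pos)) =
      ⇑f ∣[k] ((σp : GL (Fin 2) ℝ)
          * ((σq : GL (Fin 2) ℝ) * (glCast (diagGL q 1 (Nat.cast_pos.mpr (NeZero.pos q)) one_pos)))
          * (glCast (diagGL p 1 (Nat.cast_pos.mpr (NeZero.pos p)) one_pos))) := by
    rw [hfp, ← SlashAction.slash_mul, ← SlashAction.slash_mul]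
    simp only [mul_assoc]
  have C2 : (⇑fq ∣[k]
      ((σp : GL (Fin 2) ℝ) * (glCast (diagGL p 1 (Nat.cast_pos.mpr (NeZero.pos p)) one_pos)))) ∣[k]
      (glCast (diagGL q 1 (Nat.cast_pos.mpr (NeZero.pos q)) one_pos)) =
      ⇑f ∣[k] ((σq : GL (Fin 2) ℝ)
          * ((σp : GL (Fin 2) ℝ) * (glCast (diagGL p 1 (Nat.cast_pos.mpr (NeZero.pos p)) one_pos)))
          * (glCast (diagGL q 1 (Nat.cast_pos.mpr (NeZero.pos q)) one_pos))) := by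
    rw [hfq, ← SlashAction.slash_mul, ← SlashAction.slash_mul]
    simp only [mul_assoc]
  rw [K2, B1, B2, C1, C2, sum_slash_D'_beta_comm hp hq hpq k fq,
    sum_slash_D'_beta_comm hq hp hpq.symm k fp, slash_sigma_sigma_comm hσp0 hσq0 k f]
  split_ifs <;> abel


end Real


/-! ### Commutativity of the Hecke algebra -/

/-- **The Hecke algebra of `S_k(Γ₁(N))` is commutative** (discharge of `heckeAlgebra_commutative`;
Diamond–Shurman Prop. 5.2.4(c) and §5.3): the `ℂ`-algebra generated by the `T_p`, `p` prime, is
commutative, since its generators commute pairwise (`heckeT_comm_of_prime`).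
[cite: DiamondShurman2005, Prop. 5.2.4 and §5.3] -/
theorem heckeAlgebra_commutative_holds (N : ℕ) [NeZero N] (k : ℤ)
    : heckeAlgebra_commutative N k := by
  intro S T hS hT
  refine (Algebra.commute_of_mem_adjoin_of_forall_mem_commute hT fun b hb ↦ ?_).eq
  obtain ⟨q, rfl⟩ := hb
  refine (Algebra.commute_of_mem_adjoin_of_forall_mem_commute hS fun a ha ↦ ?_).symm
  obtain ⟨p, rfl⟩ := ha
  haveI : NeZero (p : ℕ) := ⟨p.2.ne_zero⟩
  haveI : NeZero (q : ℕ) := ⟨q.2.ne_zero⟩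
  exact heckeT_comm_of_prime q.2 p.2 k

end Literature.NumberTheory.EllipticCurves.ModularForms

end
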